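import Literature.Geometry.Symplectic.NearSymplecticFlatBirth
import Literature.Geometry.Symplectic.PfaffianFour
import Literature.Geometry.Symplectic.ToroidalCoordinates
import Literature.Geometry.Symplectic.GromovR4RelEndProofs
import Mathlib.Analysis.Calculus.FDeriv.Bilinear
import Mathlib.Analysis.Calculus.Deriv.Inv
import HarnessLib

/-!
# Toward the flat birth pair, I: the primitive architecture (`sf = dα`)

Proofs companion of `NearSymplecticFlatBirth.lean` (named fact
`Literature.Geometry.Symplectic.flatNearSymplecticTaubesTubes_exists`, Perutz 2006 Prop. 1.5 /
Rem. 1.9 + Honda 2004 Thm. 5 + Taubes 1998 §1.c).  Everything here is PROVED; no definitions of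
`Prop`s, no facts.

The printed proof of the fact is non-constructive (Perutz's Prop. 1.5 quotes Calabi's recognition
theorem for intrinsically harmonic `1`-forms — Calabi 1969, §V Thm. 1 with Lemma 1, Lemma 2
(Deligne) and the example of §VI — and the exact tube model comes from the Moser–Honda deformation,
Perutz 2006 Lemma 3.1).  A formal proof has to exhibit the form.  This file isolates the part of
that task which is independent of the eventual explicit construction: the form is produced as the
exterior derivative `sf := extDeriv α` of a smooth `1`-form `α` on `ℝ⁴` which is the STANDARD
PRIMITIVE `α₀ = ½(y₀dy₁ − y₁dy₀ + y₂dy₃ − y₃dy₂)` of `ω₀` off a ball.  Then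

* `sf` is `C^∞` (`contDiff_extDeriv_of_contDiff`), and CLOSED for free (`extDeriv_extDeriv_eq_zero`, Mathlib's
  `d ∘ d = 0`);
* `sf = ω₀ = stdSymplecticForm` wherever `α = α₀` nearby (`extDeriv_stdPrimitive_apply`,
  `extDeriv_apply_eq_stdSymplecticForm_of_eventuallyEq`);
* non-degeneracy of a `2`-form on `ℝ⁴` is the non-vanishing of its Pfaffian
  (`nondegenerate_of_pfaffian_ne_zero`, from the tree's `pfaffian_eq_zero_iff`);

packaged as `flatBirth_primitive_architecture`: for every smooth `1`-form `α` equal to `α₀` off the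
ball of radius `R₀`, the `2`-form `extDeriv α` satisfies the smoothness, closedness and
standard-at-infinity clauses of the fact with `R = R₀ + 1`.  The remaining clauses (two Taubes tubes
pulling `sf` back to `formT`, non-degeneracy off the cores) are about the explicit `α` and are the
subject of the sequel; see the module docstring of `NearSymplecticFlatBirth.lean` for the
architecture and the seat notes for the explicit `3`-dimensional problem it reduces to.

## References

* T. Perutz, *Zero-sets of near-symplectic forms*, J. Symplectic Geom. 4 (2006), Prop. 1.5,
  Rem. 1.9, Lemma 3.1 [Perutz2006].
* E. Calabi, *An intrinsic characterization of harmonic one-forms*, in: Global Analysis (Papers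
  in Honor of K. Kodaira), Univ. Tokyo Press / Princeton UP (1969) 101–117, §V Thm. 1, Lemmas 1–2,
  §VI [Calabi1969HarmonicOneForms].
-/

noncomputable section

open scoped ContDiff Topology
open Set Filter ContinuousAlternatingMap

namespace Literature.Geometry.Symplectic

/-- Local notation for the model space `ℝ⁴ = EuclideanSpace ℝ (Fin 4)`. -/
local notation "E4" => EuclideanSpace ℝ (Fin 4)

/-! ### Generic calculus: `1`-forms given by covector fields, smoothness of `d` -/

section Generic

variable {V : Type*} [NormedAddCommGroup V] [NormedSpace ℝ V] {n : ℕ}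

/-- **`d` of a `C^∞` form is `C^∞`** (`dω = A ∘ Dω` for the continuous linear alternatisation
`A`). [folklore] -/
theorem contDiff_extDeriv_of_contDiff {β : V → V [⋀^Fin n]→L[ℝ] ℝ} (hβ : ContDiff ℝ ∞ β) :
    ContDiff ℝ ∞ (extDeriv β) := by
  have h1 : ContDiff ℝ ∞ (fderiv ℝ β) := hβ.fderiv_right le_rfl
  have h2 : extDeriv β = fun x => alternatizeUncurryFinCLM ℝ V ℝ (fderiv ℝ β x) := by
    funext x
    rw [extDeriv, alternatizeUncurryFinCLM_apply]
  rw [h2]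
  exact (alternatizeUncurryFinCLM ℝ V ℝ).contDiff.comp h1

/-- **`d ∘ d = 0`** for a `C^∞` form (Mathlib's `extDeriv_extDeriv`). [folklore] -/
theorem extDeriv_extDeriv_eq_zero {β : V → V [⋀^Fin n]→L[ℝ] ℝ} (hβ : ContDiff ℝ ∞ β) :
    extDeriv (extDeriv β) = 0 :=
  extDeriv_extDeriv hβ (by
    rw [minSmoothness_of_isRCLikeNormedField]
    exact WithTop.coe_le_coe.mpr le_top)

/-- The `1`-form `x ↦ (v ↦ L x v)` of a covector field `L : V → V →L[ℝ] ℝ`, as a field of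
alternating maps (`ofSubsingleton`). [folklore] -/
def oneForm (L : V → V →L[ℝ] ℝ) : V → V [⋀^Fin 1]→L[ℝ] ℝ :=
  fun x => ofSubsingleton ℝ V ℝ (0 : Fin 1) (L x)

/-- Values of `oneForm L`. [folklore] -/
@[simp] theorem oneForm_apply (L : V → V →L[ℝ] ℝ) (x : V) (v : Fin 1 → V) :
    oneForm L x v = L x (v 0) := by
  simp [oneForm]

/-- The linear isometry `e : (V →L ℝ) ≃ (V [⋀^Fin 1]→L ℝ)` behind `oneForm`, as a continuous
linear map. [folklore] -/
def oneFormCLM (V : Type*) [NormedAddCommGroup V] [NormedSpace ℝ V] :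
    (V →L[ℝ] ℝ) →L[ℝ] (V [⋀^Fin 1]→L[ℝ] ℝ) :=
  ((ContinuousAlternatingMap.ofSubsingletonLIE (𝕜 := ℝ) (E := V) (F := ℝ)
    (0 : Fin 1)).toContinuousLinearEquiv : (V →L[ℝ] ℝ) →L[ℝ] (V [⋀^Fin 1]→L[ℝ] ℝ))

/-- Values of `oneFormCLM`. [folklore] -/
@[simp] theorem oneFormCLM_apply (f : V →L[ℝ] ℝ) (v : Fin 1 → V) :
    oneFormCLM V f v = f (v 0) := by
  simp [oneFormCLM]

/-- `oneForm L = e ∘ L` for the linear isometry `e = oneFormCLM`. [folklore] -/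
theorem oneForm_eq_comp (L : V → V →L[ℝ] ℝ) :
    oneForm L = fun x => oneFormCLM V (L x) := by
  funext x
  ext v
  simp

/-- **A `C^∞` covector field gives a `C^∞` `1`-form.** [folklore] -/
theorem contDiff_oneForm {L : V → V →L[ℝ] ℝ} (hL : ContDiff ℝ ∞ L) :
    ContDiff ℝ ∞ (oneForm L) := by
  rw [oneForm_eq_comp]
  exact (oneFormCLM V).contDiff.comp hL

/-- Differentiability of `oneForm L` at a point. [folklore] -/
theorem differentiableAt_oneForm {L : V → V →L[ℝ] ℝ} {x : V} (hL : DifferentiableAt ℝ L x) :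
    DifferentiableAt ℝ (oneForm L) x := by
  rw [oneForm_eq_comp]
  exact (oneFormCLM V).differentiableAt.comp x hL

/-- The derivative of `oneForm L` is `e ∘ DL`. [folklore] -/
theorem fderiv_oneForm_apply {L : V → V →L[ℝ] ℝ} {x : V} (hL : DifferentiableAt ℝ L x)
    (u : V) (v : Fin 1 → V) :
    fderiv ℝ (oneForm L) x u v = fderiv ℝ L x u (v 0) := by
  rw [oneForm_eq_comp]
  have h : HasFDerivAt (fun y => oneFormCLM V (L y)) ((oneFormCLM V).comp (fderiv ℝ L x)) x :=
    (oneFormCLM V).hasFDerivAt.comp x hL.hasFDerivAt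
  rw [h.fderiv]
  simp

/-- **`d` of a `1`-form on two vectors**: for a covector field `L`,
`d(oneForm L)_x(u, v) = (D_u L)(v) − (D_v L)(u)` (Mathlib's normalisation of `extDeriv`).
[folklore] -/
theorem extDeriv_oneForm_apply_two {L : V → V →L[ℝ] ℝ} {x : V} (hL : DifferentiableAt ℝ L x)
    (u v : V) :
    extDeriv (oneForm L) x ![u, v] = fderiv ℝ L x u v - fderiv ℝ L x v u := by
  have h := differentiableAt_oneForm hL
  rw [extDeriv_apply h, Fin.sum_univ_two]
  have h0 : Fin.removeNth (0 : Fin 2) (![u, v] : Fin 2 → V) = ![v] := by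
    funext i; fin_cases i; rfl
  have h1 : Fin.removeNth (1 : Fin 2) (![u, v] : Fin 2 → V) = ![u] := by
    funext i; fin_cases i; rfl
  simp only [h0, h1, Fin.val_zero, Fin.val_one, pow_zero, pow_one, one_smul, neg_smul,
    Matrix.cons_val_zero, Matrix.cons_val_one,
    fderiv_continuousAlternatingMap_apply_const_apply h, fderiv_oneForm_apply hL]
  simp [sub_eq_add_neg]

/-- **`d` of a LINEAR covector field**: if `L = B` is a continuous linear map
`V →L (V →L ℝ)`, then `d(oneForm B)_x(u, v) = B u v − B v u` at every point. [folklore] -/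
theorem extDeriv_oneForm_linear_apply_two (B : V →L[ℝ] (V →L[ℝ] ℝ)) (x u v : V) :
    extDeriv (oneForm (fun y => B y)) x ![u, v] = B u v - B v u := by
  rw [extDeriv_oneForm_apply_two (B.differentiableAt)]
  change ((fderiv ℝ (⇑B) x) u) v - ((fderiv ℝ (⇑B) x) v) u = (B u) v - (B v) u
  rw [B.fderiv]

end Generic

/-! ### The standard primitive `α₀ = ½(y₀dy₁ − y₁dy₀ + y₂dy₃ − y₃dy₂)` of `ω₀` on `ℝ⁴` -/

/-- The bilinear map `(y, v) ↦ ½(y₀v₁ − y₁v₀ + y₂v₃ − y₃v₂) = ½ ω₀(y, v)`, as a continuous linear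
map `ℝ⁴ →L (ℝ⁴ →L ℝ)` (so that `y ↦ α₀(y)` is linear in `y`). [folklore] -/
def stdPrimitiveCLM : E4 →L[ℝ] (E4 →L[ℝ] ℝ) :=
  (1 / 2 : ℝ) •
    ((EuclideanSpace.proj (0 : Fin 4) : E4 →L[ℝ] ℝ).smulRight
        (EuclideanSpace.proj (1 : Fin 4) : E4 →L[ℝ] ℝ) -
      (EuclideanSpace.proj (1 : Fin 4) : E4 →L[ℝ] ℝ).smulRight
        (EuclideanSpace.proj (0 : Fin 4) : E4 →L[ℝ] ℝ) +
      (EuclideanSpace.proj (2 : Fin 4) : E4 →L[ℝ] ℝ).smulRight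
        (EuclideanSpace.proj (3 : Fin 4) : E4 →L[ℝ] ℝ) -
      (EuclideanSpace.proj (3 : Fin 4) : E4 →L[ℝ] ℝ).smulRight
        (EuclideanSpace.proj (2 : Fin 4) : E4 →L[ℝ] ℝ))

/-- Values of `stdPrimitiveCLM`: `½(y₀v₁ − y₁v₀ + y₂v₃ − y₃v₂)`. [folklore] -/
@[simp] theorem stdPrimitiveCLM_apply (y v : E4) :
    stdPrimitiveCLM y v = 1 / 2 * (y 0 * v 1 - y 1 * v 0 + y 2 * v 3 - y 3 * v 2) := by
  simp [stdPrimitiveCLM]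

/-- **The standard primitive** `α₀ = ½(y₀dy₁ − y₁dy₀ + y₂dy₃ − y₃dy₂)` of the standard symplectic
form `ω₀ = dy₀∧dy₁ + dy₂∧dy₃` on `ℝ⁴`, as a field of alternating maps. [folklore] -/
def stdPrimitive : E4 → E4 [⋀^Fin 1]→L[ℝ] ℝ :=
  oneForm fun y => stdPrimitiveCLM y

/-- Values of `α₀`. [folklore] -/
@[simp] theorem stdPrimitive_apply (y : E4) (v : Fin 1 → E4) :
    stdPrimitive y v =
      1 / 2 * (y 0 * (v 0) 1 - y 1 * (v 0) 0 + y 2 * (v 0) 3 - y 3 * (v 0) 2) := by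
  simp [stdPrimitive]

/-- `α₀` is `C^∞` (it is linear). [folklore] -/
theorem contDiff_stdPrimitive : ContDiff ℝ ∞ stdPrimitive :=
  contDiff_oneForm stdPrimitiveCLM.contDiff

/-- **`dα₀ = ω₀`**: the exterior derivative of the standard primitive, evaluated on a pair of
vectors, is the standard symplectic form `stdSymplecticForm a b = a₀b₁ − a₁b₀ + a₂b₃ − a₃b₂`
(Mathlib's normalisation `dα(a, b) = D_aα(b) − D_bα(a)` of `extDeriv`). [folklore] -/
theorem extDeriv_stdPrimitive_apply (y a b : E4) :
    extDeriv stdPrimitive y ![a, b] = stdSymplecticForm a b := by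
  unfold stdPrimitive
  rw [extDeriv_oneForm_linear_apply_two, stdPrimitiveCLM_apply, stdPrimitiveCLM_apply,
    stdSymplecticForm]
  ring

/-- **Locality**: a `1`-form that agrees with `α₀` near `y` has `d = ω₀` at `y`. [folklore] -/
theorem extDeriv_apply_eq_stdSymplecticForm_of_eventuallyEq {α : E4 → E4 [⋀^Fin 1]→L[ℝ] ℝ}
    {y : E4} (h : α =ᶠ[𝓝 y] stdPrimitive) (a b : E4) :
    extDeriv α y ![a, b] = stdSymplecticForm a b := by
  rw [h.extDeriv_eq, extDeriv_stdPrimitive_apply]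

/-! ### Non-degeneracy on `ℝ⁴` is the non-vanishing of the Pfaffian -/

/-- A `2`-form on `ℝ⁴` with non-zero Pfaffian is non-degenerate in the sense of the fact
(`∀ a ≠ 0, ∃ b, Ω(a, b) ≠ 0`); the tree's degeneracy criterion `pfaffian_eq_zero_iff`.
[folklore] -/
theorem nondegenerate_of_pfaffian_ne_zero {Ω : E4 [⋀^Fin 2]→L[ℝ] ℝ} (h : pfaffian Ω ≠ 0)
    (a : E4) (ha : a ≠ 0) : ∃ b : E4, Ω ![a, b] ≠ 0 := by
  by_contra hcon
  push Not at hcon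
  exact h ((pfaffian_eq_zero_iff Ω).2 ⟨a, ha, hcon⟩)

/-! ### The primitive architecture: `sf := dα` for `α` standard off a ball -/

/-- **The primitive architecture of the flat birth pair.**  Let `α` be a `C^∞` `1`-form on `ℝ⁴`
which equals the standard primitive `α₀` at every point of `{R₀ < ‖y‖}`.  Then `sf := dα` is a
`C^∞` `2`-form, it is closed (`d sf = 0`), and it equals the standard symplectic form
`ω₀ = stdSymplecticForm` at every point of `{R₀ + 1 ≤ ‖y‖}` — i.e. `sf` satisfies the smoothness,
closedness and standard-at-infinity clauses of `flatNearSymplecticTaubesTubes_exists` with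
`R = R₀ + 1`.  (The explicit `α` carrying the two Taubes tubes is the subject of the sequel.)
[cite: Perutz2006, Prop. 1.5 and Rem. 1.9 (the form to be constructed)] -/
theorem flatBirth_primitive_architecture {α : E4 → E4 [⋀^Fin 1]→L[ℝ] ℝ} {R₀ : ℝ}
    (hα : ContDiff ℝ ∞ α) (hstd : ∀ y : E4, R₀ < ‖y‖ → α y = stdPrimitive y) :
    ContDiff ℝ ∞ (extDeriv α) ∧ extDeriv (extDeriv α) = 0 ∧
      ∀ y : E4, R₀ + 1 ≤ ‖y‖ → ∀ a b : E4, extDeriv α y ![a, b] = stdSymplecticForm a b := by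
  refine ⟨contDiff_extDeriv_of_contDiff hα, extDeriv_extDeriv_eq_zero hα, fun y hy a b => ?_⟩
  apply extDeriv_apply_eq_stdSymplecticForm_of_eventuallyEq
  have hopen : IsOpen {z : E4 | R₀ < ‖z‖} := isOpen_lt continuous_const continuous_norm
  have hmem : y ∈ {z : E4 | R₀ < ‖z‖} := by
    show R₀ < ‖y‖
    linarith
  exact Filter.eventuallyEq_of_mem (hopen.mem_nhds hmem) fun z hz => hstd z hz

/-- The same, with the non-degeneracy clause of the fact read through the Pfaffian: off any set
`Z`, `sf = dα` is non-degenerate as soon as its Pfaffian does not vanish there. [folklore] -/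
theorem flatBirth_nondegenerate_of_pfaffian {α : E4 → E4 [⋀^Fin 1]→L[ℝ] ℝ} {Z : Set E4}
    (hpf : ∀ y : E4, y ∉ Z → pfaffian (extDeriv α y) ≠ 0) :
    ∀ y : E4, y ∉ Z → ∀ a : E4, a ≠ 0 → ∃ b : E4, extDeriv α y ![a, b] ≠ 0 :=
  fun y hy a ha => nondegenerate_of_pfaffian_ne_zero (hpf y hy) a ha

/-! ### The transplant `S¹ × ℝ³ ⇝ ℝ⁴` of a `3`-dimensional pair `(g, λ)`

The eventual near-symplectic form is `t`-invariant in the picture `ℝ⁴ ∖ {axis} ≅ S¹ × {z < ½} × ℝ²`,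
`y ↦ (θ, Z(y))`, `θ = arg(y₀ + iy₁)`, `Z(y) = ((1 − y₀² − y₁²)/2, y₂, y₃)`, under which
`ω₀ = dy₀∧dy₁ + dy₂∧dy₃` corresponds to `dθ∧dz + dx₁∧dx₂` (`dy₀∧dy₁ = r dr∧dθ = dθ∧d(−r²/2)`).  A pair
`(g, λ)` of a function and a `1`-form on `ℝ³` (coordinates `q = (z, x₁, x₂) = (q 0, q 1, q 2)`)
is transplanted to the `1`-form
`α = Z*λ + (½ − g∘Z)·dθ` on `ℝ⁴`, which is the standard primitive `α₀` wherever
`(g, λ) = (z, λ₀)`, `λ₀ = ½(x₁dx₂ − x₂dx₁)` — in particular near the axis `{y₀ = y₁ = 0}`, across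
which it is therefore smooth although `dθ` is not. -/

/-- Local notation for `ℝ³ = EuclideanSpace ℝ (Fin 3)` (coordinates `(z, x₁, x₂)`). -/
local notation "E3" => EuclideanSpace ℝ (Fin 3)

/-- The squared distance to the axis, `r² = y₀² + y₁²`. [folklore] -/
def rsq (y : E4) : ℝ := y 0 ^ 2 + y 1 ^ 2

/-- `r² ≥ 0`. [folklore] -/
theorem rsq_nonneg (y : E4) : 0 ≤ rsq y := by unfold rsq; positivity

/-- `r² = 0` iff the point is on the axis `y₀ = y₁ = 0`. [folklore] -/
theorem rsq_eq_zero_iff (y : E4) : rsq y = 0 ↔ y 0 = 0 ∧ y 1 = 0 := by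
  unfold rsq
  constructor
  · intro h
    have h0 : y 0 ^ 2 = 0 := by nlinarith [sq_nonneg (y 0), sq_nonneg (y 1)]
    have h1 : y 1 ^ 2 = 0 := by nlinarith [sq_nonneg (y 0), sq_nonneg (y 1)]
    exact ⟨pow_eq_zero_iff (n := 2) (by norm_num) |>.1 h0,
      pow_eq_zero_iff (n := 2) (by norm_num) |>.1 h1⟩
  · rintro ⟨h0, h1⟩
    simp [h0, h1]

/-- `r²` is `C^∞`. [folklore] -/
theorem contDiff_rsq : ContDiff ℝ ∞ rsq := by
  unfold rsq; fun_prop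

/-- `{r² > 0}` (the complement of the axis) is open. [folklore] -/
theorem isOpen_rsq_pos : IsOpen {y : E4 | 0 < rsq y} :=
  isOpen_lt continuous_const contDiff_rsq.continuous

/-- **The map `Z : ℝ⁴ → ℝ³`, `Z(y) = ((1 − r²)/2, y₂, y₃)`** (the `ℝ³`-factor of the
identification `ℝ⁴ ∖ axis ≅ S¹ × {z < ½} × ℝ²` under which `ω₀ ↔ dθ∧dz + dx₁∧dx₂`). [folklore] -/
def zMap (y : E4) : E3 :=
  WithLp.toLp 2 ![(1 - rsq y) / 2, y 2, y 3]

/-- Components of `Z`. [folklore] -/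
@[simp] theorem zMap_apply_zero (y : E4) : zMap y 0 = (1 - rsq y) / 2 := rfl
/-- Components of `Z`. [folklore] -/
@[simp] theorem zMap_apply_one (y : E4) : zMap y 1 = y 2 := rfl
/-- Components of `Z`. [folklore] -/
@[simp] theorem zMap_apply_two (y : E4) : zMap y 2 = y 3 := rfl

/-- The derivative `dZ_y : u ↦ (−(y₀u₀ + y₁u₁), u₂, u₃)` as a linear map. [folklore] -/
def zMapDerivLin (y : E4) : E4 →ₗ[ℝ] E3 where
  toFun u := WithLp.toLp 2 ![-(y 0 * u 0 + y 1 * u 1), u 2, u 3]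
  map_add' u v := by
    ext i
    fin_cases i
    · simp; ring
    · simp
    · simp
  map_smul' c u := by
    ext i
    fin_cases i
    · simp; ring
    · simp
    · simp

/-- **The derivative `dZ_y`**: `u ↦ (−(y₀u₀ + y₁u₁), u₂, u₃)` (`d((1 − r²)/2) = −(y₀dy₀ + y₁dy₁)`).
[folklore] -/
def zMapDeriv (y : E4) : E4 →L[ℝ] E3 :=
  LinearMap.toContinuousLinearMap (zMapDerivLin y)

/-- Components of `dZ_y u`. [folklore] -/
@[simp] theorem zMapDeriv_apply_zero (y u : E4) : zMapDeriv y u 0 = -(y 0 * u 0 + y 1 * u 1) := rfl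
/-- Components of `dZ_y u`. [folklore] -/
@[simp] theorem zMapDeriv_apply_one (y u : E4) : zMapDeriv y u 1 = u 2 := rfl
/-- Components of `dZ_y u`. [folklore] -/
@[simp] theorem zMapDeriv_apply_two (y u : E4) : zMapDeriv y u 2 = u 3 := rfl

/-- **`Z` is differentiable with derivative `dZ_y`.** [folklore] -/
theorem hasFDerivAt_zMap (y : E4) : HasFDerivAt zMap (zMapDeriv y) y := by
  have hc : ∀ i : Fin 4, HasFDerivAt (fun x : E4 => x i)
      (PiLp.proj 2 (𝕜 := ℝ) (fun _ : Fin 4 => ℝ) i) y := fun i =>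
    PiLp.hasFDerivAt_apply (𝕜 := ℝ) 2 y i
  rw [← hasFDerivWithinAt_univ, hasFDerivWithinAt_euclidean]
  intro i
  rw [hasFDerivWithinAt_univ]
  fin_cases i
  · show HasFDerivAt (fun x : E4 => (1 - rsq x) / 2) _ y
    have h := ((hasFDerivAt_const (1 : ℝ) y).sub (((hc 0).pow 2).add ((hc 1).pow 2))).mul_const
      (2 : ℝ)⁻¹
    have h' : HasFDerivAt (fun x : E4 => (1 - rsq x) / 2) _ y :=
      h.congr_of_eventuallyEq (Eventually.of_forall fun x => by
        simp [rsq, div_eq_mul_inv])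
    refine h'.congr_fderiv ?_
    ext u
    simp [zMapDeriv, zMapDerivLin]
    ring
  · show HasFDerivAt (fun x : E4 => x 2) _ y
    exact (hc 2).congr_fderiv (ContinuousLinearMap.ext fun u => rfl)
  · show HasFDerivAt (fun x : E4 => x 3) _ y
    exact (hc 3).congr_fderiv (ContinuousLinearMap.ext fun u => rfl)

/-- `fderiv` of `Z`. [folklore] -/
theorem fderiv_zMap (y : E4) : fderiv ℝ zMap y = zMapDeriv y := (hasFDerivAt_zMap y).fderiv

/-- **`Z` is `C^∞`** (polynomial). [folklore] -/
theorem contDiff_zMap : ContDiff ℝ ∞ zMap := by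
  rw [contDiff_euclidean]
  intro i
  fin_cases i
  · show ContDiff ℝ ∞ (fun x : E4 => (1 - rsq x) / 2)
    unfold rsq; fun_prop
  · show ContDiff ℝ ∞ (fun x : E4 => x 2)
    fun_prop
  · show ContDiff ℝ ∞ (fun x : E4 => x 3)
    fun_prop

/-- **The angle form `dθ = (y₀dy₁ − y₁dy₀)/r²`** as a covector field on `ℝ⁴` (junk value `0` on the
axis, where `(r²)⁻¹ = 0`); `= toroidalDt` of `HondaUntwistedModel.lean` as a function. [folklore] -/
def thetaCov (y : E4) : E4 →L[ℝ] ℝ :=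
  (rsq y)⁻¹ • (y 0 • (EuclideanSpace.proj (1 : Fin 4) : E4 →L[ℝ] ℝ) -
    y 1 • (EuclideanSpace.proj (0 : Fin 4) : E4 →L[ℝ] ℝ))

/-- Values of `dθ`. [folklore] -/
@[simp] theorem thetaCov_apply (y v : E4) : thetaCov y v = (rsq y)⁻¹ * (y 0 * v 1 - y 1 * v 0) := by
  simp [thetaCov]

/-- `dθ` is `C^∞` off the axis. [folklore] -/
theorem contDiffOn_thetaCov : ContDiffOn ℝ ∞ thetaCov {y : E4 | 0 < rsq y} := by
  intro y hy
  have hne : rsq y ≠ 0 := (ne_of_gt hy)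
  have hf : ContDiffAt ℝ ∞ (fun x : E4 => (rsq x)⁻¹) y := (contDiff_rsq.contDiffAt).inv hne
  have hg : ContDiffAt ℝ ∞ (fun x : E4 => (x 0 • (EuclideanSpace.proj (1 : Fin 4) : E4 →L[ℝ] ℝ) -
      x 1 • (EuclideanSpace.proj (0 : Fin 4) : E4 →L[ℝ] ℝ))) y := by
    fun_prop
  have h : ContDiffAt ℝ ∞ thetaCov y := hf.smul hg
  exact h.contDiffWithinAt

/-- `dθ` is `C^∞` at every point off the axis. [folklore] -/
theorem contDiffAt_thetaCov {y : E4} (hy : 0 < rsq y) : ContDiffAt ℝ ∞ thetaCov y :=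
  (contDiffOn_thetaCov y hy).contDiffAt (isOpen_rsq_pos.mem_nhds hy)

/-- **The standard `3`-dimensional primitive** `λ₀ = ½(x₁dx₂ − x₂dx₁)` of `dx₁∧dx₂` on `ℝ³`
(coordinates `(z, x₁, x₂) = (q 0, q 1, q 2)`), as a continuous linear map `ℝ³ →L (ℝ³ →L ℝ)`.
[folklore] -/
def stdCov3 : E3 →L[ℝ] (E3 →L[ℝ] ℝ) :=
  (1 / 2 : ℝ) •
    ((EuclideanSpace.proj (1 : Fin 3) : E3 →L[ℝ] ℝ).smulRight
        (EuclideanSpace.proj (2 : Fin 3) : E3 →L[ℝ] ℝ) -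
      (EuclideanSpace.proj (2 : Fin 3) : E3 →L[ℝ] ℝ).smulRight
        (EuclideanSpace.proj (1 : Fin 3) : E3 →L[ℝ] ℝ))

/-- Values of `λ₀`. [folklore] -/
@[simp] theorem stdCov3_apply (q w : E3) : stdCov3 q w = 1 / 2 * (q 1 * w 2 - q 2 * w 1) := by
  simp [stdCov3]

/-- **The transplanted `1`-form** `α = Z*λ + (½ − g∘Z)·dθ` of a `3`-dimensional pair `(g, λ)`
(a function and a covector field on `ℝ³`), as a covector field on `ℝ⁴`.  Under
`ℝ⁴ ∖ axis ≅ S¹ × {z < ½} × ℝ²` its exterior derivative corresponds to the `t`-invariant form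
`dt∧dg + dλ` (Perutz 2006, proof of Prop. 1.5: `ω_{f,g} = df∧dt + ⋆_g df` with `⋆_g df =: dλ`).
[cite: Perutz2006, proof of Prop. 1.5] -/
def birthCov (g : E3 → ℝ) (lam : E3 → E3 →L[ℝ] ℝ) (y : E4) : E4 →L[ℝ] ℝ :=
  (lam (zMap y)).comp (zMapDeriv y) + (1 / 2 - g (zMap y)) • thetaCov y

/-- Values of the transplanted form. [folklore] -/
theorem birthCov_apply (g : E3 → ℝ) (lam : E3 → E3 →L[ℝ] ℝ) (y v : E4) :
    birthCov g lam y v =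
      lam (zMap y) (zMapDeriv y v) + (1 / 2 - g (zMap y)) * ((rsq y)⁻¹ * (y 0 * v 1 - y 1 * v 0)) := by
  simp [birthCov]

/-- **Standardness**: at a point `y` where the pair is standard at `Z(y)` — `g(Z y) = z(Z y)` and
`λ(Z y) = λ₀(Z y)` — the transplanted form IS the standard primitive `α₀` of `ω₀` (including on the
axis, where both sides reduce to `½(y₂dy₃ − y₃dy₂)`):
`Z*λ₀ = ½(y₂dy₃ − y₃dy₂)` and `(½ − (1 − r²)/2)·dθ = ½(y₀dy₁ − y₁dy₀)`. [folklore] -/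
theorem birthCov_eq_stdPrimitiveCLM {g : E3 → ℝ} {lam : E3 → E3 →L[ℝ] ℝ} {y : E4}
    (hg : g (zMap y) = zMap y 0) (hl : lam (zMap y) = stdCov3 (zMap y)) :
    birthCov g lam y = stdPrimitiveCLM y := by
  ext v
  rw [birthCov_apply, hl, hg, stdCov3_apply, stdPrimitiveCLM_apply]
  simp only [zMap_apply_zero, zMap_apply_one, zMap_apply_two, zMapDeriv_apply_one,
    zMapDeriv_apply_two]
  by_cases h : rsq y = 0
  · obtain ⟨h0, h1⟩ := (rsq_eq_zero_iff y).1 h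
    rw [h, h0, h1]
    ring
  · unfold rsq at h ⊢
    field_simp
    ring

/-- **Smoothness of the transplanted form off the axis**, for a `C^∞` pair. [folklore] -/
theorem contDiffAt_birthCov {g : E3 → ℝ} {lam : E3 → E3 →L[ℝ] ℝ} (hg : ContDiff ℝ ∞ g)
    (hl : ContDiff ℝ ∞ lam) {y : E4} (hy : 0 < rsq y) : ContDiffAt ℝ ∞ (birthCov g lam) y := by
  unfold birthCov
  apply ContDiffAt.add
  · have h1 : ContDiffAt ℝ ∞ (fun x => lam (zMap x)) y := (hl.comp contDiff_zMap).contDiffAt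
    have h2 : ContDiffAt ℝ ∞ (fun x => zMapDeriv x) y := by
      have : (fun x => zMapDeriv x) = fderiv ℝ zMap := by
        funext x; rw [fderiv_zMap]
      rw [this]
      exact (contDiff_zMap.fderiv_right le_rfl).contDiffAt
    exact h1.clm_comp h2
  · have h1 : ContDiffAt ℝ ∞ (fun x => 1 / 2 - g (zMap x)) y :=
      contDiffAt_const.sub ((hg.comp contDiff_zMap).contDiffAt)
    exact h1.smul (contDiffAt_thetaCov hy)

/-- **The standard region hypothesis.**  We say the pair `(g, λ)` is *standard above height
`½ − η` and outside radius `R₁`* if `g = z` and `λ = λ₀` at every `q` with `½ − η < q 0` or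
`R₁ < ‖q‖`; then the transplanted form is the standard primitive `α₀` near the axis
(`r² < 2η`) — hence smooth there — and far away. [folklore] -/
theorem birthCov_eq_stdPrimitiveCLM_of_rsq_lt {g : E3 → ℝ} {lam : E3 → E3 →L[ℝ] ℝ} {η : ℝ}
    (hstd : ∀ q : E3, 1 / 2 - η < q 0 → g q = q 0 ∧ lam q = stdCov3 q) {y : E4}
    (hy : rsq y < 2 * η) : birthCov g lam y = stdPrimitiveCLM y := by
  have h : 1 / 2 - η < zMap y 0 := by
    rw [zMap_apply_zero]
    linarith
  exact birthCov_eq_stdPrimitiveCLM (hstd _ h).1 (hstd _ h).2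

/-- Far from the origin of `ℝ⁴`, `Z` is far from the origin of `ℝ³`: if `2 R₁ + 3 ≤ ‖y‖`
(and `0 ≤ R₁`) then `R₁ < ‖Z y‖`. [folklore] -/
theorem lt_norm_zMap_of_le_norm {R₁ : ℝ} (hR₁ : 0 ≤ R₁) {y : E4} (hy : 2 * R₁ + 3 ≤ ‖y‖) :
    R₁ < ‖zMap y‖ := by
  have hn : ‖y‖ ^ 2 = y 0 ^ 2 + y 1 ^ 2 + y 2 ^ 2 + y 3 ^ 2 := by
    rw [EuclideanSpace.norm_sq_eq]
    simp [Fin.sum_univ_four, Real.norm_eq_abs, sq_abs]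
  have hz : ‖zMap y‖ ^ 2 = ((1 - rsq y) / 2) ^ 2 + y 2 ^ 2 + y 3 ^ 2 := by
    rw [EuclideanSpace.norm_sq_eq]
    simp [Fin.sum_univ_three, Real.norm_eq_abs, sq_abs]
  have hy2 : (2 * R₁ + 3) ^ 2 ≤ ‖y‖ ^ 2 := by
    have : 0 ≤ 2 * R₁ + 3 := by linarith
    nlinarith
  -- either the planar part or the `(y₂, y₃)` part is large
  by_contra hcon
  push Not at hcon
  have hzle : ‖zMap y‖ ^ 2 ≤ R₁ ^ 2 := by
    have h0 : 0 ≤ ‖zMap y‖ := norm_nonneg _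
    nlinarith
  rw [hz] at hzle
  rw [hn] at hy2
  unfold rsq at hzle
  nlinarith [sq_nonneg (y 0 ^ 2 + y 1 ^ 2 - 1 - 2 * R₁), sq_nonneg (y 2), sq_nonneg (y 3),
    sq_nonneg R₁, sq_nonneg (y 0), sq_nonneg (y 1)]

/-- Far from the origin the transplanted form is the standard primitive, for a pair that is
standard outside radius `R₁`. [folklore] -/
theorem birthCov_eq_stdPrimitiveCLM_of_le_norm {g : E3 → ℝ} {lam : E3 → E3 →L[ℝ] ℝ} {R₁ : ℝ}
    (hR₁ : 0 ≤ R₁) (hstd : ∀ q : E3, R₁ < ‖q‖ → g q = q 0 ∧ lam q = stdCov3 q) {y : E4}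
    (hy : 2 * R₁ + 3 ≤ ‖y‖) : birthCov g lam y = stdPrimitiveCLM y :=
  birthCov_eq_stdPrimitiveCLM (hstd _ (lt_norm_zMap_of_le_norm hR₁ hy)).1
    (hstd _ (lt_norm_zMap_of_le_norm hR₁ hy)).2

/-- **The transplanted form is `C^∞` on all of `ℝ⁴`** for a `C^∞` pair that is standard above
height `½ − η` (`η > 0`): off the axis by the chain rule, near the axis because it is `α₀` there.
[folklore] -/
theorem contDiff_birthCov {g : E3 → ℝ} {lam : E3 → E3 →L[ℝ] ℝ} {η : ℝ} (hη : 0 < η)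
    (hg : ContDiff ℝ ∞ g) (hl : ContDiff ℝ ∞ lam)
    (hstd : ∀ q : E3, 1 / 2 - η < q 0 → g q = q 0 ∧ lam q = stdCov3 q) :
    ContDiff ℝ ∞ (birthCov g lam) := by
  rw [contDiff_iff_contDiffAt]
  intro y
  by_cases hy : 0 < rsq y
  · exact contDiffAt_birthCov hg hl hy
  · -- on the axis: `birthCov = stdPrimitiveCLM` on the neighbourhood `{r² < 2η}`
    have hopen : IsOpen {x : E4 | rsq x < 2 * η} := isOpen_lt contDiff_rsq.continuous continuous_const
    have hmem : y ∈ {x : E4 | rsq x < 2 * η} := by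
      show rsq y < 2 * η
      have := rsq_nonneg y
      linarith
    have heq : (birthCov g lam) =ᶠ[𝓝 y] fun x => stdPrimitiveCLM x :=
      Filter.eventuallyEq_of_mem (hopen.mem_nhds hmem) fun x hx =>
        birthCov_eq_stdPrimitiveCLM_of_rsq_lt hstd hx
    exact (stdPrimitiveCLM.contDiff.contDiffAt).congr_of_eventuallyEq heq

/-- **The transplanted `2`-form `sf = dα` of a `C^∞` pair standard above height `½ − η` and outside
radius `R₁` satisfies the smoothness, closedness and standard-at-infinity clauses of the fact**
with `R = 2R₁ + 4`. [cite: Perutz2006, proof of Prop. 1.5] -/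
theorem birthForm_architecture {g : E3 → ℝ} {lam : E3 → E3 →L[ℝ] ℝ} {η R₁ : ℝ} (hη : 0 < η)
    (hR₁ : 0 ≤ R₁) (hg : ContDiff ℝ ∞ g) (hl : ContDiff ℝ ∞ lam)
    (hstd : ∀ q : E3, (1 / 2 - η < q 0 ∨ R₁ < ‖q‖) → g q = q 0 ∧ lam q = stdCov3 q) :
    ContDiff ℝ ∞ (extDeriv (oneForm (birthCov g lam))) ∧
      extDeriv (extDeriv (oneForm (birthCov g lam))) = 0 ∧
      ∀ y : E4, 2 * R₁ + 4 ≤ ‖y‖ → ∀ a b : E4,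
        extDeriv (oneForm (birthCov g lam)) y ![a, b] = stdSymplecticForm a b := by
  have hsm : ContDiff ℝ ∞ (oneForm (birthCov g lam)) :=
    contDiff_oneForm (contDiff_birthCov hη hg hl fun q hq => hstd q (Or.inl hq))
  have h := flatBirth_primitive_architecture (R₀ := 2 * R₁ + 3) hsm fun y hy => by
    show oneForm (birthCov g lam) y = stdPrimitive y
    unfold stdPrimitive
    rw [oneForm_eq_comp, oneForm_eq_comp]
    simp only
    rw [birthCov_eq_stdPrimitiveCLM_of_le_norm hR₁ (fun q hq => hstd q (Or.inr hq)) hy.le]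
  refine ⟨h.1, h.2.1, fun y hy a b => h.2.2 y (by linarith) a b⟩

/-! ### The values of `d(Z*λ + (½ − g∘Z)dθ)` off the axis, and its Pfaffian

Off the axis, `dα = Z*(dλ) + dθ ∧ Z*(dg)` (the terms `λ_{Z y} ∘ D²Z_y` and `(½ − g∘Z)·d(dθ)` drop
out by the symmetry of second derivatives and the closedness of `dθ`), and the Pfaffian of this
`2`-form is the density `D = (dλ ∧ dg)/(dz∧dx₁∧dx₂)` of the pair at `Z(y)` (the Jacobian
`dθ∧dz∧dx₁∧dx₂ ↔ dy₀∧dy₁∧dy₂∧dy₃` is `1`: `dy₀∧dy₁ = r dr∧dθ = dθ∧d(−r²/2)`).  So the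
transplanted form is non-degenerate exactly over the positivity set of `D`. -/

section Values

variable {g : E3 → ℝ} {lam : E3 → E3 →L[ℝ] ℝ}

/-- Evaluation commutes with differentiation of covector fields:
`(D f_y u)(v) = D(x ↦ f_x(v))_y u`. [folklore] -/
theorem fderiv_clm_apply_comm {W : Type*} [NormedAddCommGroup W] [NormedSpace ℝ W]
    {f : E4 → W →L[ℝ] ℝ} {y : E4} (hf : DifferentiableAt ℝ f y) (u : E4) (v : W) :
    fderiv ℝ f y u v = fderiv ℝ (fun x => f x v) y u := by
  rw [fderiv_clm_apply hf (differentiableAt_const v)]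
  simp

/-- The scalar components `x ↦ dθ_x(v)` of the angle form and their derivatives off the axis:
`D(dθ(v))_y u = (u₀v₁ − u₁v₀)/r² − 2(y₀u₀ + y₁u₁)(y₀v₁ − y₁v₀)/r⁴`. [folklore] -/
theorem hasFDerivAt_thetaCov_apply {y : E4} (hy : 0 < rsq y) (v : E4) :
    HasFDerivAt (fun x : E4 => thetaCov x v)
      ((rsq y)⁻¹ • (v 1 • (EuclideanSpace.proj (0 : Fin 4) : E4 →L[ℝ] ℝ) -
          v 0 • (EuclideanSpace.proj (1 : Fin 4) : E4 →L[ℝ] ℝ)) +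
        (-((2 * y 0 * (y 0 * v 1 - y 1 * v 0)) / rsq y ^ 2) •
            (EuclideanSpace.proj (0 : Fin 4) : E4 →L[ℝ] ℝ) +
          -((2 * y 1 * (y 0 * v 1 - y 1 * v 0)) / rsq y ^ 2) •
            (EuclideanSpace.proj (1 : Fin 4) : E4 →L[ℝ] ℝ))) y := by
  have hc : ∀ i : Fin 4, HasFDerivAt (fun x : E4 => x i)
      (PiLp.proj 2 (𝕜 := ℝ) (fun _ : Fin 4 => ℝ) i) y := fun i =>
    PiLp.hasFDerivAt_apply (𝕜 := ℝ) 2 y i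
  have hne : rsq y ≠ 0 := ne_of_gt hy
  have hr : HasFDerivAt rsq
      (((2 : ℕ) • y 0 ^ (2 - 1)) • PiLp.proj 2 (𝕜 := ℝ) (fun _ : Fin 4 => ℝ) 0 +
        ((2 : ℕ) • y 1 ^ (2 - 1)) • PiLp.proj 2 (𝕜 := ℝ) (fun _ : Fin 4 => ℝ) 1) y := by
    have := ((hc 0).pow 2).add ((hc 1).pow 2)
    refine this.congr_of_eventuallyEq (Eventually.of_forall fun x => ?_)
    simp only [rsq, Pi.add_apply]
  have hinv : HasFDerivAt (fun x : E4 => (rsq x)⁻¹)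
      ((ContinuousLinearMap.toSpanSingleton ℝ (-(rsq y ^ 2)⁻¹)).comp
        (((2 : ℕ) • y 0 ^ (2 - 1)) • PiLp.proj 2 (𝕜 := ℝ) (fun _ : Fin 4 => ℝ) 0 +
          ((2 : ℕ) • y 1 ^ (2 - 1)) • PiLp.proj 2 (𝕜 := ℝ) (fun _ : Fin 4 => ℝ) 1)) y :=
    (hasFDerivAt_inv hne).comp y hr
  have hnum : HasFDerivAt (fun x : E4 => x 0 * v 1 - x 1 * v 0)
      (v 1 • PiLp.proj 2 (𝕜 := ℝ) (fun _ : Fin 4 => ℝ) 0 -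
        v 0 • PiLp.proj 2 (𝕜 := ℝ) (fun _ : Fin 4 => ℝ) 1) y := by
    have := ((hc 0).mul_const (v 1)).sub ((hc 1).mul_const (v 0))
    refine this.congr_of_eventuallyEq (Eventually.of_forall fun x => ?_)
    simp only [Pi.sub_apply]
  have h := hinv.mul hnum
  have h' : HasFDerivAt (fun x : E4 => thetaCov x v) _ y :=
    h.congr_of_eventuallyEq (Eventually.of_forall fun x => by
      simp only [thetaCov_apply, Pi.mul_apply])
  refine h'.congr_fderiv ?_
  ext u
  simp only [_root_.add_apply, _root_.smul_apply, _root_.sub_apply, PiLp.proj_apply,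
    smul_eq_mul, ContinuousLinearMap.coe_comp, Function.comp_apply,
    nsmul_eq_mul, Nat.cast_ofNat, ContinuousLinearMap.toSpanSingleton_apply]
  unfold rsq at hne ⊢
  field_simp
  ring

/-- `x ↦ dθ_x(v)` is differentiable off the axis. [folklore] -/
theorem differentiableAt_thetaCov {y : E4} (hy : 0 < rsq y) : DifferentiableAt ℝ thetaCov y :=
  (contDiffAt_thetaCov hy).differentiableAt (by simp)

/-- **`dθ` is closed off the axis**: the derivative of the covector field `dθ` is symmetric,
`(D dθ_y u)(v) = (D dθ_y v)(u)`. [folklore] -/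
theorem fderiv_thetaCov_symm {y : E4} (hy : 0 < rsq y) (u v : E4) :
    fderiv ℝ thetaCov y u v = fderiv ℝ thetaCov y v u := by
  rw [fderiv_clm_apply_comm (differentiableAt_thetaCov hy) u v,
    fderiv_clm_apply_comm (differentiableAt_thetaCov hy) v u,
    (hasFDerivAt_thetaCov_apply hy v).fderiv, (hasFDerivAt_thetaCov_apply hy u).fderiv]
  have hne : rsq y ≠ 0 := ne_of_gt hy
  simp only [_root_.add_apply, _root_.smul_apply, _root_.sub_apply, smul_eq_mul, EuclideanSpace.coe_proj]
  unfold rsq at hne ⊢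
  field_simp
  ring

/-- `dZ` is the derivative of `Z` as functions. [folklore] -/
theorem zMapDeriv_eq_fderiv : zMapDeriv = fderiv ℝ zMap := by
  funext y; rw [fderiv_zMap]

/-- **The second derivative of `Z` is symmetric** (it is `C^∞`). [folklore] -/
theorem fderiv_zMapDeriv_symm (y u v : E4) :
    fderiv ℝ zMapDeriv y u v = fderiv ℝ zMapDeriv y v u := by
  rw [zMapDeriv_eq_fderiv]
  exact (contDiff_zMap.contDiffAt (x := y)).isSymmSndFDerivAt (n := ∞) (by
    rw [minSmoothness_of_isRCLikeNormedField]
    exact WithTop.coe_le_coe.mpr le_top) u v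

/-- `Z*λ` is differentiable, with the Leibniz derivative. [folklore] -/
theorem hasFDerivAt_pullback_lam (hl : ContDiff ℝ ∞ lam) (y : E4) :
    HasFDerivAt (fun x => (lam (zMap x)).comp (zMapDeriv x))
      ((ContinuousLinearMap.compL ℝ E4 E3 ℝ (lam (zMap y))).comp (fderiv ℝ zMapDeriv y) +
        ((ContinuousLinearMap.compL ℝ E4 E3 ℝ).flip (zMapDeriv y)).comp
          ((fderiv ℝ lam (zMap y)).comp (zMapDeriv y))) y := by
  have hc : HasFDerivAt (fun x => lam (zMap x)) ((fderiv ℝ lam (zMap y)).comp (zMapDeriv y)) y := by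
    have h1 : HasFDerivAt lam (fderiv ℝ lam (zMap y)) (zMap y) :=
      ((hl.differentiable (by simp)) _).hasFDerivAt
    exact h1.comp y (hasFDerivAt_zMap y)
  have hd : HasFDerivAt zMapDeriv (fderiv ℝ zMapDeriv y) y := by
    have : Differentiable ℝ zMapDeriv := by
      rw [zMapDeriv_eq_fderiv]
      exact (contDiff_zMap.fderiv_right (m := ∞) le_rfl).differentiable (by simp)
    exact (this y).hasFDerivAt
  exact hc.clm_comp hd

/-- `(½ − g∘Z)·dθ` is differentiable off the axis, with the Leibniz derivative. [folklore] -/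
theorem hasFDerivAt_smul_thetaCov (hg : ContDiff ℝ ∞ g) {y : E4} (hy : 0 < rsq y) :
    HasFDerivAt (fun x => (1 / 2 - g (zMap x)) • thetaCov x)
      ((1 / 2 - g (zMap y)) • fderiv ℝ thetaCov y +
        (-((fderiv ℝ g (zMap y)).comp (zMapDeriv y))).smulRight (thetaCov y)) y := by
  have hc : HasFDerivAt (fun x => 1 / 2 - g (zMap x)) (-((fderiv ℝ g (zMap y)).comp (zMapDeriv y))) y := by
    have h1 : HasFDerivAt g (fderiv ℝ g (zMap y)) (zMap y) :=
      ((hg.differentiable (by simp)) _).hasFDerivAt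
    have h2 := (h1.comp y (hasFDerivAt_zMap y))
    have h3 := (hasFDerivAt_const (1 / 2 : ℝ) y).sub h2
    refine h3.congr_fderiv ?_
    simp
  have hd : HasFDerivAt thetaCov (fderiv ℝ thetaCov y) y :=
    (differentiableAt_thetaCov hy).hasFDerivAt
  exact hc.smul hd

/-- **The values of the transplanted `2`-form off the axis**:
`dα_y(u, v) = (Dλ_{Z y}(dZ u))(dZ v) − (Dλ_{Z y}(dZ v))(dZ u) + dθ(u)·dg_{Z y}(dZ v) − dθ(v)·dg_{Z y}(dZ u)`,
i.e. `dα = Z*(dλ) + dθ ∧ Z*(dg)` (`= dt∧dg + dλ` read on `S¹ × ℝ³`; Perutz 2006, proof of Prop. 1.5,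
`ω_{f,g} = df∧dt + ⋆_g df` up to the orientation of `t`). [cite: Perutz2006, proof of Prop. 1.5] -/
theorem extDeriv_birthForm_apply (hg : ContDiff ℝ ∞ g) (hl : ContDiff ℝ ∞ lam) {y : E4}
    (hy : 0 < rsq y) (u v : E4) :
    extDeriv (oneForm (birthCov g lam)) y ![u, v] =
      fderiv ℝ lam (zMap y) (zMapDeriv y u) (zMapDeriv y v) -
          fderiv ℝ lam (zMap y) (zMapDeriv y v) (zMapDeriv y u) +
        (thetaCov y u * fderiv ℝ g (zMap y) (zMapDeriv y v) -
          thetaCov y v * fderiv ℝ g (zMap y) (zMapDeriv y u)) := by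
  have hdiff : DifferentiableAt ℝ (birthCov g lam) y :=
    (contDiffAt_birthCov hg hl hy).differentiableAt (by simp)
  rw [extDeriv_oneForm_apply_two hdiff]
  have hD : HasFDerivAt (birthCov g lam) _ y :=
    (hasFDerivAt_pullback_lam hl y).add (hasFDerivAt_smul_thetaCov hg hy)
  rw [show birthCov g lam = fun x => (lam (zMap x)).comp (zMapDeriv x) +
      (1 / 2 - g (zMap x)) • thetaCov x from rfl] at hD ⊢
  rw [hD.fderiv]
  have hsymZ := congrArg (fun w : E3 => lam (zMap y) w) (fderiv_zMapDeriv_symm y u v)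
  have hsymT := fderiv_thetaCov_symm hy u v
  simp only [_root_.add_apply, ContinuousLinearMap.coe_comp, Function.comp_apply,
    ContinuousLinearMap.compL_apply, ContinuousLinearMap.flip_apply, _root_.smul_apply,
    ContinuousLinearMap.smulRight_apply, _root_.neg_apply, smul_eq_mul] at hsymZ ⊢
  linear_combination hsymZ + (1 / 2 - g (zMap y)) * hsymT

/-- The standard basis vectors of `ℝ³`. [folklore] -/
def stdVec3 (i : Fin 3) : E3 := EuclideanSpace.single i (1 : ℝ)

/-- Coordinates of the standard basis vectors of `ℝ³`. [folklore] -/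
@[simp] theorem stdVec3_apply (i j : Fin 3) : stdVec3 i j = if j = i then 1 else 0 := by
  simp [stdVec3]

/-- **The density `D = (dλ ∧ dg)/(dz∧dx₁∧dx₂)` of a pair `(g, λ)` on `ℝ³`** in coordinates:
with `B(a, b) = (Dλ_q a)(b) − (Dλ_q b)(a)` (`= dλ_q(a, b)`) and `dg_q = Dg_q`,
`D(q) = B(e₀,e₁) dg(e₂) − B(e₀,e₂) dg(e₁) + B(e₁,e₂) dg(e₀)`.  For `dλ = ι_V dvol` this is `V·∇g`.
[cite: Calabi1969HarmonicOneForms, §V Lemma 1 (the transversal `(n−1)`-form `ψ`, `α∧ψ > 0`)] -/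
def density3 (g : E3 → ℝ) (lam : E3 → E3 →L[ℝ] ℝ) (q : E3) : ℝ :=
  (fderiv ℝ lam q (stdVec3 0) (stdVec3 1) - fderiv ℝ lam q (stdVec3 1) (stdVec3 0)) *
      fderiv ℝ g q (stdVec3 2) -
    (fderiv ℝ lam q (stdVec3 0) (stdVec3 2) - fderiv ℝ lam q (stdVec3 2) (stdVec3 0)) *
      fderiv ℝ g q (stdVec3 1) +
    (fderiv ℝ lam q (stdVec3 1) (stdVec3 2) - fderiv ℝ lam q (stdVec3 2) (stdVec3 1)) *
      fderiv ℝ g q (stdVec3 0)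

/-- `dZ` on the standard basis: `dZ e₀ = −y₀ e'₀`. [folklore] -/
theorem zMapDeriv_stdVec_zero (y : E4) : zMapDeriv y (stdVec 0) = (-y 0) • stdVec3 0 := by
  ext i; fin_cases i <;> simp [stdVec, stdVec3]
/-- `dZ` on the standard basis: `dZ e₁ = −y₁ e'₀`. [folklore] -/
theorem zMapDeriv_stdVec_one (y : E4) : zMapDeriv y (stdVec 1) = (-y 1) • stdVec3 0 := by
  ext i; fin_cases i <;> simp [stdVec, stdVec3]
/-- `dZ` on the standard basis: `dZ e₂ = e'₁`. [folklore] -/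
theorem zMapDeriv_stdVec_two (y : E4) : zMapDeriv y (stdVec 2) = stdVec3 1 := by
  ext i; fin_cases i <;> simp [stdVec, stdVec3]
/-- `dZ` on the standard basis: `dZ e₃ = e'₂`. [folklore] -/
theorem zMapDeriv_stdVec_three (y : E4) : zMapDeriv y (stdVec 3) = stdVec3 2 := by
  ext i; fin_cases i <;> simp [stdVec, stdVec3]

/-- **The Pfaffian of the transplanted form is the density of the pair**: off the axis,
`Pf(dα_y) = D(Z y)` (`dα ∧ dα = 2 D(Z y) dy₀∧dy₁∧dy₂∧dy₃`).  Hence `dα` is non-degenerate at `y`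
iff `D(Z y) ≠ 0`. [cite: Perutz2006, proof of Prop. 1.5 (`ω_{f,g}` is symplectic off `Crit f`)] -/
theorem pfaffian_extDeriv_birthForm (hg : ContDiff ℝ ∞ g) (hl : ContDiff ℝ ∞ lam) {y : E4}
    (hy : 0 < rsq y) :
    pfaffian (extDeriv (oneForm (birthCov g lam)) y) = density3 g lam (zMap y) := by
  have hne : rsq y ≠ 0 := ne_of_gt hy
  simp only [pfaffian, extDeriv_birthForm_apply hg hl hy, zMapDeriv_stdVec_zero,
    zMapDeriv_stdVec_one, zMapDeriv_stdVec_two, zMapDeriv_stdVec_three, map_smul,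
    _root_.smul_apply, smul_eq_mul, thetaCov_apply,
    stdVec_apply, density3]
  simp only [Fin.isValue, Fin.reduceEq, if_true, if_false, mul_one, mul_zero, sub_zero, zero_sub]
  unfold rsq at hne ⊢
  field_simp
  ring

/-- **Non-degeneracy over the positivity set of the density**: off the axis, the transplanted
`2`-form is non-degenerate at `y` as soon as `D(Z y) ≠ 0`. [folklore] -/
theorem extDeriv_birthForm_nondegenerate (hg : ContDiff ℝ ∞ g) (hl : ContDiff ℝ ∞ lam) {y : E4}
    (hy : 0 < rsq y) (hD : density3 g lam (zMap y) ≠ 0) (a : E4) (ha : a ≠ 0) :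
    ∃ b : E4, extDeriv (oneForm (birthCov g lam)) y ![a, b] ≠ 0 :=
  nondegenerate_of_pfaffian_ne_zero (by rwa [pfaffian_extDeriv_birthForm hg hl hy]) a ha

end Values

/-! ### Taubes' tube form is exact: `formT = d(T*α_A)`, `α_A = −Q dt + λ_H`, `λ_H = −c(a db − b da)`

In the flat toroidal coordinates `(t, a, b, c) = (arg(y₀+iy₁), r − 1, y₂, y₃)` about the unit
circle, Honda's model `ω_A = dt∧dQ + ⋆₃dQ` (`Q = ½(a² + b²) − c²`) has the primitive
`α_A = −Q dt + λ_H` with `dλ_H = ⋆₃ dQ = a db∧dc + b dc∧da − 2c da∧db`; pulled back to `ℝ⁴` this is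
the covector field `tubeCov = −Q·dθ − c·((r − 1)dy₂ − y₂ dr)`, and its exterior derivative is
LITERALLY `untwistedTubeForm` (= the `let formT` of the named fact). -/

section Tube

/-- **The radial form `dr = (y₀dy₀ + y₁dy₁)/r`** as a covector field (junk `0` on the axis);
`= toroidalDa` as a function. [folklore] -/
def daCov (y : E4) : E4 →L[ℝ] ℝ :=
  (toroidalR y)⁻¹ • (y 0 • (EuclideanSpace.proj (0 : Fin 4) : E4 →L[ℝ] ℝ) +
    y 1 • (EuclideanSpace.proj (1 : Fin 4) : E4 →L[ℝ] ℝ))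

/-- Values of `dr`. [folklore] -/
@[simp] theorem daCov_apply (y u : E4) : daCov y u = (toroidalR y)⁻¹ * (y 0 * u 0 + y 1 * u 1) := by
  simp [daCov, mul_add]

/-- `daCov` is the `toroidalDa` of `HondaUntwistedModel`. [folklore] -/
theorem daCov_apply_eq_toroidalDa (y u : E4) : daCov y u = toroidalDa y u := by
  rw [daCov_apply, toroidalDa, div_eq_inv_mul]

/-- `r² = toroidalR²`. [folklore] -/
theorem rsq_eq_toroidalR_sq (y : E4) : rsq y = toroidalR y ^ 2 := by
  rw [toroidalR_sq]; rfl

/-- `thetaCov` is the `toroidalDt` of `HondaUntwistedModel`. [folklore] -/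
theorem thetaCov_apply_eq_toroidalDt (y u : E4) : thetaCov y u = toroidalDt y u := by
  rw [thetaCov_apply, toroidalDt, rsq_eq_toroidalR_sq, div_eq_inv_mul]

/-- Off the axis `toroidalR` is positive iff `rsq` is. [folklore] -/
theorem rsq_pos_of_toroidalR_pos {y : E4} (hy : 0 < toroidalR y) : 0 < rsq y := by
  rw [rsq_eq_toroidalR_sq]; positivity

/-- **`dr` is the derivative of `r`** off the axis (the tree's `hasFDerivAt_toroidalR`, with the
derivative written as the covector `daCov y`). [folklore] -/
theorem hasFDerivAt_toroidalR_daCov {y : E4} (hy : 0 < toroidalR y) :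
    HasFDerivAt toroidalR (daCov y) y := by
  refine (hasFDerivAt_toroidalR hy).congr_fderiv ?_
  ext u
  rw [ContinuousLinearMap.coe_comp, Function.comp_apply, PiLp.proj_apply, toroidalDeriv_apply_one,
    daCov_apply_eq_toroidalDa]

/-- `dr` is `C^∞` off the axis. [folklore] -/
theorem contDiffAt_daCov {y : E4} (hy : 0 < toroidalR y) : ContDiffAt ℝ ∞ daCov y := by
  have hf : ContDiffAt ℝ ∞ (fun x : E4 => (toroidalR x)⁻¹) y :=
    (contDiffAt_toroidalR hy).inv hy.ne'
  have hg : ContDiffAt ℝ ∞ (fun x : E4 => (x 0 • (EuclideanSpace.proj (0 : Fin 4) : E4 →L[ℝ] ℝ) +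
      x 1 • (EuclideanSpace.proj (1 : Fin 4) : E4 →L[ℝ] ℝ))) y := by
    fun_prop
  exact hf.smul hg

/-- The scalar components `x ↦ dr_x(v)` and their derivatives off the axis:
`D(dr(v))_y u = (u₀v₀ + u₁v₁)/r − (y₀v₀ + y₁v₁) dr(u)/r²`. [folklore] -/
theorem hasFDerivAt_daCov_apply {y : E4} (hy : 0 < toroidalR y) (v : E4) :
    HasFDerivAt (fun x : E4 => daCov x v)
      ((toroidalR y)⁻¹ • (v 0 • (EuclideanSpace.proj (0 : Fin 4) : E4 →L[ℝ] ℝ) +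
          v 1 • (EuclideanSpace.proj (1 : Fin 4) : E4 →L[ℝ] ℝ)) +
        (-((y 0 * v 0 + y 1 * v 1) / toroidalR y ^ 2)) • daCov y) y := by
  have hc : ∀ i : Fin 4, HasFDerivAt (fun x : E4 => x i)
      (PiLp.proj 2 (𝕜 := ℝ) (fun _ : Fin 4 => ℝ) i) y := fun i =>
    PiLp.hasFDerivAt_apply (𝕜 := ℝ) 2 y i
  have hr : toroidalR y ≠ 0 := hy.ne'
  have hinv : HasFDerivAt (fun x : E4 => (toroidalR x)⁻¹)
      ((ContinuousLinearMap.toSpanSingleton ℝ (-(toroidalR y ^ 2)⁻¹)).comp (daCov y)) y :=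
    (hasFDerivAt_inv hr).comp y (hasFDerivAt_toroidalR_daCov hy)
  have hnum : HasFDerivAt (fun x : E4 => x 0 * v 0 + x 1 * v 1)
      (v 0 • PiLp.proj 2 (𝕜 := ℝ) (fun _ : Fin 4 => ℝ) 0 +
        v 1 • PiLp.proj 2 (𝕜 := ℝ) (fun _ : Fin 4 => ℝ) 1) y := by
    have := ((hc 0).mul_const (v 0)).add ((hc 1).mul_const (v 1))
    refine this.congr_of_eventuallyEq (Eventually.of_forall fun x => ?_)
    simp only [Pi.add_apply]
  have h := hinv.mul hnum
  have h' : HasFDerivAt (fun x : E4 => daCov x v) _ y :=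
    h.congr_of_eventuallyEq (Eventually.of_forall fun x => by
      simp only [daCov_apply, Pi.mul_apply])
  refine h'.congr_fderiv ?_
  ext u
  simp only [_root_.add_apply, _root_.smul_apply, PiLp.proj_apply, smul_eq_mul,
    ContinuousLinearMap.coe_comp, Function.comp_apply, ContinuousLinearMap.toSpanSingleton_apply,
    daCov_apply]
  field_simp

/-- `daCov` is differentiable off the axis. [folklore] -/
theorem differentiableAt_daCov {y : E4} (hy : 0 < toroidalR y) : DifferentiableAt ℝ daCov y :=
  (contDiffAt_daCov hy).differentiableAt (by simp)

/-- **`dr` is closed off the axis**: `(D dr_y u)(v) = (D dr_y v)(u)`. [folklore] -/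
theorem fderiv_daCov_symm {y : E4} (hy : 0 < toroidalR y) (u v : E4) :
    fderiv ℝ daCov y u v = fderiv ℝ daCov y v u := by
  rw [fderiv_clm_apply_comm (differentiableAt_daCov hy) u v,
    fderiv_clm_apply_comm (differentiableAt_daCov hy) v u,
    (hasFDerivAt_daCov_apply hy v).fderiv, (hasFDerivAt_daCov_apply hy u).fderiv]
  have hr : toroidalR y ≠ 0 := hy.ne'
  simp only [_root_.add_apply, _root_.smul_apply, smul_eq_mul, EuclideanSpace.coe_proj, daCov_apply]
  field_simp

/-- **`Q = ½(a² + b²) − c²`** in the flat toroidal coordinates `a = r − 1`, `b = y₂`, `c = y₃`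
(Honda 2004 §4 (A); Taubes 1998 eq. (1.1)). [cite: Taubes1998S1B3, eq. (1.1)] -/
def tubeQ (y : E4) : ℝ :=
  1 / 2 * ((toroidalR y - 1) ^ 2 + y 2 ^ 2) - y 3 ^ 2

/-- **`dQ = a da + b db − 2c dc`** off the axis: the derivative of `tubeQ` is the covector
`(r − 1) dr + y₂ dy₂ − 2y₃ dy₃` (`= untwistedDQ`). [folklore] -/
theorem hasFDerivAt_tubeQ {y : E4} (hy : 0 < toroidalR y) :
    HasFDerivAt tubeQ ((toroidalR y - 1) • daCov y +
      y 2 • (EuclideanSpace.proj (2 : Fin 4) : E4 →L[ℝ] ℝ) -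
      (2 * y 3) • (EuclideanSpace.proj (3 : Fin 4) : E4 →L[ℝ] ℝ)) y := by
  have hc : ∀ i : Fin 4, HasFDerivAt (fun x : E4 => x i)
      (PiLp.proj 2 (𝕜 := ℝ) (fun _ : Fin 4 => ℝ) i) y := fun i =>
    PiLp.hasFDerivAt_apply (𝕜 := ℝ) 2 y i
  have hR := hasFDerivAt_toroidalR_daCov hy
  have h := ((((hR.sub_const 1).pow 2).add ((hc 2).pow 2)).const_mul (1 / 2 : ℝ)).sub
    ((hc 3).pow 2)
  have h' : HasFDerivAt tubeQ _ y :=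
    h.congr_of_eventuallyEq (Eventually.of_forall fun x => by
      simp only [tubeQ, Pi.sub_apply, Pi.add_apply])
  refine h'.congr_fderiv ?_
  ext u
  simp only [_root_.add_apply, _root_.smul_apply, _root_.sub_apply, PiLp.proj_apply, smul_eq_mul,
    nsmul_eq_mul, Nat.cast_ofNat, daCov_apply]
  ring

/-- `dQ(u) = untwistedDQ y u`. [folklore] -/
theorem fderiv_tubeQ_apply {y : E4} (hy : 0 < toroidalR y) (u : E4) :
    fderiv ℝ tubeQ y u = untwistedDQ y u := by
  rw [(hasFDerivAt_tubeQ hy).fderiv, untwistedDQ, ← daCov_apply_eq_toroidalDa]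
  simp only [_root_.add_apply, _root_.smul_apply, _root_.sub_apply, smul_eq_mul,
    EuclideanSpace.coe_proj]

/-- `Q` is `C^∞` off the axis. [folklore] -/
theorem contDiffAt_tubeQ {y : E4} (hy : 0 < toroidalR y) : ContDiffAt ℝ ∞ tubeQ y := by
  have hR := contDiffAt_toroidalR hy
  unfold tubeQ
  have h1 : ContDiffAt ℝ ∞ (fun x : E4 => x 2) y := by fun_prop
  have h2 : ContDiffAt ℝ ∞ (fun x : E4 => x 3) y := by fun_prop
  exact ((contDiffAt_const.mul (((hR.sub contDiffAt_const).pow 2).add (h1.pow 2))).sub (h2.pow 2))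

/-- The `λ_H`-part `G = (r − 1) dy₂ − y₂ dr` of the tube primitive, as a covector field.
[folklore] -/
def tubeG (y : E4) : E4 →L[ℝ] ℝ :=
  (toroidalR y - 1) • (EuclideanSpace.proj (2 : Fin 4) : E4 →L[ℝ] ℝ) - y 2 • daCov y

/-- Values of `G`. [folklore] -/
@[simp] theorem tubeG_apply (y u : E4) :
    tubeG y u = (toroidalR y - 1) * u 2 - y 2 * ((toroidalR y)⁻¹ * (y 0 * u 0 + y 1 * u 1)) := by
  simp [tubeG]

/-- `G` is `C^∞` off the axis. [folklore] -/
theorem contDiffAt_tubeG {y : E4} (hy : 0 < toroidalR y) : ContDiffAt ℝ ∞ tubeG y := by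
  unfold tubeG
  have h1 : ContDiffAt ℝ ∞ (fun x : E4 => (toroidalR x - 1) •
      (EuclideanSpace.proj (2 : Fin 4) : E4 →L[ℝ] ℝ)) y :=
    ((contDiffAt_toroidalR hy).sub contDiffAt_const).smul contDiffAt_const
  have h2 : ContDiffAt ℝ ∞ (fun x : E4 => x 2 • daCov x) y := by
    have : ContDiffAt ℝ ∞ (fun x : E4 => x 2) y := by fun_prop
    exact this.smul (contDiffAt_daCov hy)
  exact h1.sub h2

/-- The derivative of `G`, with its symmetric remainder isolated:
`DG_y u = dr(u)·dy₂ − u₂·dr − y₂·D(dr)_y u`. [folklore] -/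
theorem hasFDerivAt_tubeG {y : E4} (hy : 0 < toroidalR y) :
    HasFDerivAt tubeG ((daCov y).smulRight (EuclideanSpace.proj (2 : Fin 4) : E4 →L[ℝ] ℝ) -
      (y 2 • fderiv ℝ daCov y +
        (EuclideanSpace.proj (2 : Fin 4) : E4 →L[ℝ] ℝ).smulRight (daCov y))) y := by
  have h1 : HasFDerivAt (fun x : E4 => (toroidalR x - 1) •
      (EuclideanSpace.proj (2 : Fin 4) : E4 →L[ℝ] ℝ))
      ((daCov y).smulRight (EuclideanSpace.proj (2 : Fin 4) : E4 →L[ℝ] ℝ)) y := by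
    have := ((hasFDerivAt_toroidalR_daCov hy).sub_const 1).smul_const
      (EuclideanSpace.proj (2 : Fin 4) : E4 →L[ℝ] ℝ)
    exact this
  have h2 : HasFDerivAt (fun x : E4 => x 2 • daCov x)
      (y 2 • fderiv ℝ daCov y +
        (EuclideanSpace.proj (2 : Fin 4) : E4 →L[ℝ] ℝ).smulRight (daCov y)) y := by
    have hc : HasFDerivAt (fun x : E4 => x 2) (EuclideanSpace.proj (2 : Fin 4) : E4 →L[ℝ] ℝ) y :=
      PiLp.hasFDerivAt_apply (𝕜 := ℝ) 2 y 2
    exact hc.smul (differentiableAt_daCov hy).hasFDerivAt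
  exact h1.sub h2

/-- **The tube primitive `T*α_A = −Q·dθ − c·((r − 1)dy₂ − y₂ dr)`** (`α_A = −Q dt + λ_H`,
`λ_H = −c(a db − b da)`, `dλ_H = ⋆₃dQ`), as a covector field on `ℝ⁴` (meaningful off the axis).
[cite: Honda2004LocalSD, §4 Thm. 4 (A)] -/
def tubeCov (y : E4) : E4 →L[ℝ] ℝ :=
  (-tubeQ y) • thetaCov y + (-(y 3)) • tubeG y

/-- Values of the tube primitive. [folklore] -/
theorem tubeCov_apply (y u : E4) :
    tubeCov y u = -tubeQ y * thetaCov y u + -(y 3) * tubeG y u := by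
  simp [tubeCov]

/-- The tube primitive is `C^∞` off the axis. [folklore] -/
theorem contDiffAt_tubeCov {y : E4} (hy : 0 < toroidalR y) : ContDiffAt ℝ ∞ tubeCov y := by
  unfold tubeCov
  have h1 : ContDiffAt ℝ ∞ (fun x : E4 => (-tubeQ x) • thetaCov x) y :=
    (contDiffAt_tubeQ hy).neg.smul (contDiffAt_thetaCov (rsq_pos_of_toroidalR_pos hy))
  have h2 : ContDiffAt ℝ ∞ (fun x : E4 => (-(x 3)) • tubeG x) y := by
    have : ContDiffAt ℝ ∞ (fun x : E4 => -(x 3)) y := by fun_prop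
    exact this.smul (contDiffAt_tubeG hy)
  exact h1.add h2

/-- **`d(T*α_A) = formT`**: off the axis, the exterior derivative of the tube primitive on a pair
of vectors is LITERALLY Taubes' untwisted tube form `untwistedTubeForm y u v` (the `let formT`
of the named fact): `d(−Q dt) = dt∧dQ` (`d dt = 0`) and
`d(−c((r−1)dy₂ − y₂dr)) = (r−1) dy₂∧dy₃ + y₂ dy₃∧dr − 2y₃ dr∧dy₂` (`d dr = 0`).
[cite: Taubes1998S1B3, eq. (1.1)] [cite: Honda2004LocalSD, §4 Thm. 4 (A)] -/
theorem extDeriv_tubeForm_apply {y : E4} (hy : 0 < toroidalR y) (u v : E4) :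
    extDeriv (oneForm tubeCov) y ![u, v] = untwistedTubeForm y u v := by
  have hrsq : 0 < rsq y := rsq_pos_of_toroidalR_pos hy
  have hdiff : DifferentiableAt ℝ tubeCov y := (contDiffAt_tubeCov hy).differentiableAt (by simp)
  rw [extDeriv_oneForm_apply_two hdiff]
  have hQ : HasFDerivAt (fun x : E4 => -tubeQ x) (-(fderiv ℝ tubeQ y)) y :=
    ((hasFDerivAt_tubeQ hy).differentiableAt.hasFDerivAt).neg
  have h1 : HasFDerivAt (fun x : E4 => (-tubeQ x) • thetaCov x)
      ((-tubeQ y) • fderiv ℝ thetaCov y + (-(fderiv ℝ tubeQ y)).smulRight (thetaCov y)) y :=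
    hQ.smul (differentiableAt_thetaCov hrsq).hasFDerivAt
  have h3 : HasFDerivAt (fun x : E4 => -(x 3)) (-(EuclideanSpace.proj (3 : Fin 4) : E4 →L[ℝ] ℝ)) y :=
    (PiLp.hasFDerivAt_apply (𝕜 := ℝ) 2 y 3).neg
  have h2 : HasFDerivAt (fun x : E4 => (-(x 3)) • tubeG x)
      ((-(y 3)) • ((daCov y).smulRight (EuclideanSpace.proj (2 : Fin 4) : E4 →L[ℝ] ℝ) -
          (y 2 • fderiv ℝ daCov y +
            (EuclideanSpace.proj (2 : Fin 4) : E4 →L[ℝ] ℝ).smulRight (daCov y))) +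
        (-(EuclideanSpace.proj (3 : Fin 4) : E4 →L[ℝ] ℝ)).smulRight (tubeG y)) y :=
    h3.smul (hasFDerivAt_tubeG hy)
  have hD : HasFDerivAt tubeCov _ y := h1.add h2
  rw [show tubeCov = fun x => (-tubeQ x) • thetaCov x + (-(x 3)) • tubeG x from rfl] at hD ⊢
  rw [hD.fderiv]
  have hsymT := fderiv_thetaCov_symm hrsq u v
  have hsymA := fderiv_daCov_symm hy u v
  have hQu := fderiv_tubeQ_apply hy u
  have hQv := fderiv_tubeQ_apply hy v
  simp only [_root_.add_apply, _root_.sub_apply, _root_.smul_apply, _root_.neg_apply,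
    ContinuousLinearMap.smulRight_apply, smul_eq_mul, EuclideanSpace.coe_proj, tubeG_apply,
    daCov_apply] at ⊢
  rw [hQu, hQv, thetaCov_apply_eq_toroidalDt, thetaCov_apply_eq_toroidalDt, untwistedTubeForm,
    toroidalDa, toroidalDa, div_eq_inv_mul, div_eq_inv_mul]
  linear_combination (-tubeQ y) * hsymT + (y 3 * y 2) * hsymA

end Tube

/-! ## II. The tubes and the reduction to an explicit `3`-dimensional pair

With the transplant `α' = Z*λ + (½ − g∘Z)dθ` of part I and the exactness `formT = d(T*α_A)` above,
the remaining clauses of `flatNearSymplecticTaubesTubes_exists` are discharged here for ANY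
`C^∞` pair `(g, λ)` on `ℝ³` that is standard above height `½ − η` and off a ball, has Honda's germ
(`dg = ε dQ`, `dλ = ⋆₃dQ` in an affine chart `ξ ↦ p + Bξ`) at two points `p₁, p₂`, and has
non-vanishing density `D = (dλ∧dg)/dvol` elsewhere:

* the tube maps are EXPLICIT and angle-free, `Ψ(y) = (σy₀, εσy₁, P(y)₁, P(y)₂)` with
  `P = p + B∘T`, `T = (r − 1, y₂, y₃)`, `σ = √(1 − 2P₀)/r`, so that `Z∘Ψ = P` and `dθ∘dΨ = ε dθ`
  (`tubePsi`, `zMap_tubePsi`, `thetaCov_tubePsi`; the derivative identity `dZ∘dΨ = B∘dT` is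
  obtained from `Z∘Ψ = P` by uniqueness of derivatives, `zMapDeriv_comp_tubePsiDeriv`);
* `Ψ* dα' = formT` pointwise (`birthForm_tubePsi_pullback`), `Ψ` is a smooth injective immersion
  of the flat solid torus into a ball (`isFlatTaubesTube_tubePsi`), the two tube images are
  disjoint, and `dα'` is non-degenerate off the two core circles (`Pf = D∘Z` off the axis,
  `dα' = ω₀` on the axis, `Z⁻¹(pᵢ) ∩ {r > 0} = Ψᵢ(C₀)`);

all assembled in `flatNearSymplecticTaubesTubes_exists_of_calabiPair`.  What this leaves of the
named fact is a purely `3`-dimensional, explicit task: exhibit such a pair `(g, λ)` (Calabi's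
example `f = x(r² − 1) + y² − z²` of an intrinsically harmonic form with an index-`1`/index-`2`
pair, Calabi 1969 §VI, made explicit together with its transversal `2`-form and deformed to the
exact germs). -/

section TubeMap

/-! #### Honda's linear model data on `ℝ³` -/

/-- `dQ_ξ(w) = a w₀ + b w₁ − 2c w₂` for `Q = ½(a² + b²) − c²`, `ξ = (a, b, c)`.
[cite: Honda2004LocalSD, §4 Thm. 4 (A)] -/
def modelDQ3 (ξ w : E3) : ℝ := ξ 0 * w 0 + ξ 1 * w 1 - 2 * ξ 2 * w 2

/-- `⋆₃dQ_ξ(v, w) = a (v₁w₂ − v₂w₁) + b (v₂w₀ − v₀w₂) − 2c (v₀w₁ − v₁w₀)`.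
[cite: Honda2004LocalSD, §4 Thm. 4 (A)] -/
def modelStarDQ3 (ξ v w : E3) : ℝ :=
  ξ 0 * (v 1 * w 2 - v 2 * w 1) + ξ 1 * (v 2 * w 0 - v 0 * w 2) - 2 * ξ 2 * (v 0 * w 1 - v 1 * w 0)

/-! #### The normal coordinates `T = (r − 1, y₂, y₃)` and their derivative -/

/-- **`T(y) = (r − 1, y₂, y₃)`**, the normal flat toroidal coordinates about the unit circle
(`toroidalMap` without its angle). [cite: Taubes1998S1B3, §1.c] -/
def tubeT (y : E4) : E3 := WithLp.toLp 2 ![toroidalR y - 1, y 2, y 3]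

/-- Components of `T`. [folklore] -/
@[simp] theorem tubeT_apply_zero (y : E4) : tubeT y 0 = toroidalR y - 1 := rfl
/-- Components of `T`. [folklore] -/
@[simp] theorem tubeT_apply_one (y : E4) : tubeT y 1 = y 2 := rfl
/-- Components of `T`. [folklore] -/
@[simp] theorem tubeT_apply_two (y : E4) : tubeT y 2 = y 3 := rfl

/-- `dT_y : u ↦ (dr(u), u₂, u₃)` as a linear map. [folklore] -/
def tubeTDerivLin (y : E4) : E4 →ₗ[ℝ] E3 where
  toFun u := WithLp.toLp 2 ![daCov y u, u 2, u 3]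
  map_add' u v := by
    ext i
    fin_cases i
    · simp; ring
    · simp
    · simp
  map_smul' c u := by
    ext i
    fin_cases i
    · simp
    · simp
    · simp

/-- **`dT_y : u ↦ (dr(u), u₂, u₃)`.** [folklore] -/
def tubeTDeriv (y : E4) : E4 →L[ℝ] E3 :=
  LinearMap.toContinuousLinearMap (tubeTDerivLin y)

/-- Components of `dT_y u`. [folklore] -/
@[simp] theorem tubeTDeriv_apply_zero (y u : E4) : tubeTDeriv y u 0 = daCov y u := rfl
/-- Components of `dT_y u`. [folklore] -/
@[simp] theorem tubeTDeriv_apply_one (y u : E4) : tubeTDeriv y u 1 = u 2 := rfl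
/-- Components of `dT_y u`. [folklore] -/
@[simp] theorem tubeTDeriv_apply_two (y u : E4) : tubeTDeriv y u 2 = u 3 := rfl

/-- **`T` is differentiable off the axis with derivative `dT_y`.** [folklore] -/
theorem hasFDerivAt_tubeT {y : E4} (hy : 0 < toroidalR y) : HasFDerivAt tubeT (tubeTDeriv y) y := by
  have hc : ∀ i : Fin 4, HasFDerivAt (fun x : E4 => x i)
      (PiLp.proj 2 (𝕜 := ℝ) (fun _ : Fin 4 => ℝ) i) y := fun i =>
    PiLp.hasFDerivAt_apply (𝕜 := ℝ) 2 y i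
  rw [← hasFDerivWithinAt_univ, hasFDerivWithinAt_euclidean]
  intro i
  rw [hasFDerivWithinAt_univ]
  fin_cases i
  · show HasFDerivAt (fun x : E4 => toroidalR x - 1) _ y
    refine ((hasFDerivAt_toroidalR_daCov hy).sub_const 1).congr_fderiv ?_
    ext u
    rfl
  · show HasFDerivAt (fun x : E4 => x 2) _ y
    exact (hc 2).congr_fderiv (ContinuousLinearMap.ext fun u => rfl)
  · show HasFDerivAt (fun x : E4 => x 3) _ y
    exact (hc 3).congr_fderiv (ContinuousLinearMap.ext fun u => rfl)

/-- `T` is `C^∞` off the axis. [folklore] -/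
theorem contDiffAt_tubeT {y : E4} (hy : 0 < toroidalR y) : ContDiffAt ℝ ∞ tubeT y := by
  rw [contDiffAt_euclidean]
  intro i
  fin_cases i
  · show ContDiffAt ℝ ∞ (fun x : E4 => toroidalR x - 1) y
    exact (contDiffAt_toroidalR hy).sub contDiffAt_const
  · show ContDiffAt ℝ ∞ (fun x : E4 => x 2) y
    fun_prop
  · show ContDiffAt ℝ ∞ (fun x : E4 => x 3) y
    fun_prop

/-- `‖T y‖² = (r − 1)² + y₂² + y₃²`. [folklore] -/
theorem norm_tubeT_sq (y : E4) : ‖tubeT y‖ ^ 2 = (toroidalR y - 1) ^ 2 + y 2 ^ 2 + y 3 ^ 2 := by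
  rw [EuclideanSpace.norm_sq_eq]
  simp [Fin.sum_univ_three, Real.norm_eq_abs, sq_abs]

/-- On the flat solid torus of radius `δ`, `‖T y‖ < δ`. [folklore] -/
theorem norm_tubeT_lt {δ : ℝ} (hδ : 0 < δ) {y : E4} (hy : y ∈ flatSolidTorus δ) : ‖tubeT y‖ < δ := by
  rw [mem_flatSolidTorus] at hy
  rw [← norm_tubeT_sq] at hy
  exact lt_of_pow_lt_pow_left₀ 2 hδ.le hy

/-! #### The base map `P = p + B ∘ T`, the scale `σ = √(1 − 2P₀)/r`, the tube map `Ψ` -/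

variable (p : E3) (B : E3 →L[ℝ] E3) (ε : ℝ)

/-- **`P(y) = p + B(T y)`**: the `ℝ³`-part of the tube in the `Z`-picture (an affine image of
the normal coordinates). [folklore] -/
def tubeP (y : E4) : E3 := p + B (tubeT y)

/-- **`σ(y) = √(1 − 2P(y)₀) / r`**: the radial rescaling making `Z ∘ Ψ = P`. [folklore] -/
def tubeSigma (y : E4) : ℝ := Real.sqrt (1 - 2 * tubeP p B y 0) / toroidalR y

/-- **The tube map `Ψ(y) = (σ y₀, ε σ y₁, P(y)₁, P(y)₂)`** (`ε = ±1` the orientation of the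
circle direction): `Z ∘ Ψ = P` and `θ ∘ dΨ = ε θ`, so `Ψ` is `Φ⁻¹ ∘ (εt, P) ` for the
identification `Φ = (θ, Z)` of `ℝ⁴ ∖ axis` with `S¹ × {z < ½} × ℝ²`, written without any angle.
[folklore] -/
def tubePsi (y : E4) : E4 :=
  WithLp.toLp 2
    ![tubeSigma p B y * y 0, ε * (tubeSigma p B y * y 1), tubeP p B y 1, tubeP p B y 2]

/-- Components of `Ψ`. [folklore] -/
@[simp] theorem tubePsi_apply_zero (y : E4) : tubePsi p B ε y 0 = tubeSigma p B y * y 0 := rfl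
/-- Components of `Ψ`. [folklore] -/
@[simp] theorem tubePsi_apply_one (y : E4) :
    tubePsi p B ε y 1 = ε * (tubeSigma p B y * y 1) := rfl
/-- Components of `Ψ`. [folklore] -/
@[simp] theorem tubePsi_apply_two (y : E4) : tubePsi p B ε y 2 = tubeP p B y 1 := rfl
/-- Components of `Ψ`. [folklore] -/
@[simp] theorem tubePsi_apply_three (y : E4) : tubePsi p B ε y 3 = tubeP p B y 2 := rfl

/-- The derivative of `Ψ` as a linear map, in terms of the (abstract) derivative of `σ`.
[folklore] -/
def tubePsiDerivLin (y : E4) : E4 →ₗ[ℝ] E4 where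
  toFun u := WithLp.toLp 2
    ![tubeSigma p B y * u 0 + y 0 * fderiv ℝ (tubeSigma p B) y u,
      ε * (tubeSigma p B y * u 1 + y 1 * fderiv ℝ (tubeSigma p B) y u),
      B (tubeTDeriv y u) 1, B (tubeTDeriv y u) 2]
  map_add' u v := by
    ext i
    fin_cases i
    · simp; ring
    · simp; ring
    · simp
    · simp
  map_smul' c u := by
    ext i
    fin_cases i
    · simp; ring
    · simp; ring
    · simp
    · simp

/-- **The derivative `dΨ_y`**: `u ↦ (σu₀ + y₀ dσ(u), ε(σu₁ + y₁ dσ(u)), (B dT u)₁, (B dT u)₂)`.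
[folklore] -/
def tubePsiDeriv (y : E4) : E4 →L[ℝ] E4 :=
  LinearMap.toContinuousLinearMap (tubePsiDerivLin p B ε y)

/-- Components of `dΨ_y u`. [folklore] -/
@[simp] theorem tubePsiDeriv_apply_zero (y u : E4) :
    tubePsiDeriv p B ε y u 0 = tubeSigma p B y * u 0 + y 0 * fderiv ℝ (tubeSigma p B) y u := rfl
/-- Components of `dΨ_y u`. [folklore] -/
@[simp] theorem tubePsiDeriv_apply_one (y u : E4) :
    tubePsiDeriv p B ε y u 1 = ε * (tubeSigma p B y * u 1 + y 1 * fderiv ℝ (tubeSigma p B) y u) :=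
  rfl
/-- Components of `dΨ_y u`. [folklore] -/
@[simp] theorem tubePsiDeriv_apply_two (y u : E4) :
    tubePsiDeriv p B ε y u 2 = B (tubeTDeriv y u) 1 := rfl
/-- Components of `dΨ_y u`. [folklore] -/
@[simp] theorem tubePsiDeriv_apply_three (y u : E4) :
    tubePsiDeriv p B ε y u 3 = B (tubeTDeriv y u) 2 := rfl

variable {p B ε}

/-- `P` is differentiable off the axis, `dP_y = B ∘ dT_y`. [folklore] -/
theorem hasFDerivAt_tubeP {y : E4} (hy : 0 < toroidalR y) :
    HasFDerivAt (tubeP p B) (B.comp (tubeTDeriv y)) y :=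
  (B.hasFDerivAt.comp y (hasFDerivAt_tubeT hy)).const_add p

/-- `P` is `C^∞` off the axis. [folklore] -/
theorem contDiffAt_tubeP {y : E4} (hy : 0 < toroidalR y) : ContDiffAt ℝ ∞ (tubeP p B) y :=
  contDiffAt_const.add (B.contDiff.contDiffAt.comp y (contDiffAt_tubeT hy))

/-- The height component `P₀` is `C^∞` off the axis. [folklore] -/
theorem contDiffAt_tubeP_zero {y : E4} (hy : 0 < toroidalR y) :
    ContDiffAt ℝ ∞ (fun x => tubeP p B x 0) y :=
  contDiffAt_euclidean.1 (contDiffAt_tubeP hy) 0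

/-- `σ` is `C^∞` where `r > 0` and `2P₀ < 1`. [folklore] -/
theorem contDiffAt_tubeSigma {y : E4} (hy : 0 < toroidalR y) (hs : 2 * tubeP p B y 0 < 1) :
    ContDiffAt ℝ ∞ (tubeSigma p B) y := by
  have h1 : ContDiffAt ℝ ∞ (fun x => 1 - 2 * tubeP p B x 0) y :=
    contDiffAt_const.sub (contDiffAt_const.mul (contDiffAt_tubeP_zero hy))
  have h2 : ContDiffAt ℝ ∞ (fun x => Real.sqrt (1 - 2 * tubeP p B x 0)) y :=
    h1.sqrt (by linarith)
  exact h2.div (contDiffAt_toroidalR hy) hy.ne'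

/-- `σ > 0` where `r > 0` and `2P₀ < 1`. [folklore] -/
theorem tubeSigma_pos {y : E4} (hy : 0 < toroidalR y) (hs : 2 * tubeP p B y 0 < 1) :
    0 < tubeSigma p B y :=
  div_pos (Real.sqrt_pos.2 (by linarith)) hy

/-- `σ r = √(1 − 2P₀)`. [folklore] -/
theorem tubeSigma_mul_toroidalR {y : E4} (hy : 0 < toroidalR y) :
    tubeSigma p B y * toroidalR y = Real.sqrt (1 - 2 * tubeP p B y 0) := by
  unfold tubeSigma
  field_simp

/-- `σ² r² = 1 − 2P₀`. [folklore] -/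
theorem tubeSigma_sq_mul {y : E4} (hy : 0 < toroidalR y) (hs : 2 * tubeP p B y 0 < 1) :
    tubeSigma p B y ^ 2 * (y 0 ^ 2 + y 1 ^ 2) = 1 - 2 * tubeP p B y 0 := by
  rw [← toroidalR_sq, ← mul_pow, tubeSigma_mul_toroidalR hy, Real.sq_sqrt (by linarith)]

/-- Near a point with `r > 0` and `2P₀ < 1` both inequalities persist. [folklore] -/
theorem eventually_tube_nhds {y : E4} (hy : 0 < toroidalR y) (hs : 2 * tubeP p B y 0 < 1) :
    ∀ᶠ x in 𝓝 y, 0 < toroidalR x ∧ 2 * tubeP p B x 0 < 1 := by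
  have h1 : ∀ᶠ x in 𝓝 y, 0 < toroidalR x :=
    (contDiffAt_toroidalR hy).continuousAt.eventually_const_lt hy
  have h2 : ∀ᶠ x in 𝓝 y, 2 * tubeP p B x 0 < 1 := by
    have hc : ContinuousAt (fun x => 2 * tubeP p B x 0) y :=
      (continuousAt_const.mul (contDiffAt_tubeP_zero hy).continuousAt)
    exact hc.eventually_lt_const hs
  exact h1.and h2

/-- **`Ψ` is differentiable with derivative `dΨ_y`** where `r > 0` and `2P₀ < 1`. [folklore] -/
theorem hasFDerivAt_tubePsi {y : E4} (hy : 0 < toroidalR y) (hs : 2 * tubeP p B y 0 < 1) :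
    HasFDerivAt (tubePsi p B ε) (tubePsiDeriv p B ε y) y := by
  have hc : ∀ i : Fin 4, HasFDerivAt (fun x : E4 => x i)
      (PiLp.proj 2 (𝕜 := ℝ) (fun _ : Fin 4 => ℝ) i) y := fun i =>
    PiLp.hasFDerivAt_apply (𝕜 := ℝ) 2 y i
  have hσ : HasFDerivAt (tubeSigma p B) (fderiv ℝ (tubeSigma p B) y) y :=
    ((contDiffAt_tubeSigma hy hs).differentiableAt (by simp)).hasFDerivAt
  have hP := hasFDerivAt_tubeP (p := p) (B := B) hy
  have hPc : ∀ j : Fin 3, HasFDerivAt (fun x : E4 => tubeP p B x j)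
      ((PiLp.proj 2 (𝕜 := ℝ) (fun _ : Fin 3 => ℝ) j).comp (B.comp (tubeTDeriv y))) y := fun j =>
    (PiLp.hasFDerivAt_apply (𝕜 := ℝ) 2 (tubeP p B y) j).comp y hP
  rw [← hasFDerivWithinAt_univ, hasFDerivWithinAt_euclidean]
  intro i
  rw [hasFDerivWithinAt_univ]
  fin_cases i
  · show HasFDerivAt (fun x : E4 => tubeSigma p B x * x 0) _ y
    refine (hσ.mul (hc 0)).congr_fderiv ?_
    ext u
    simp only [_root_.add_apply, _root_.smul_apply, PiLp.proj_apply, smul_eq_mul,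
      ContinuousLinearMap.coe_comp, Function.comp_apply]
    show tubeSigma p B y * u 0 + y 0 * fderiv ℝ (tubeSigma p B) y u = _
    rfl
  · show HasFDerivAt (fun x : E4 => ε * (tubeSigma p B x * x 1)) _ y
    refine ((hσ.mul (hc 1)).const_mul ε).congr_fderiv ?_
    ext u
    simp only [_root_.add_apply, _root_.smul_apply, PiLp.proj_apply, smul_eq_mul,
      ContinuousLinearMap.coe_comp, Function.comp_apply]
    show ε * (tubeSigma p B y * u 1 + y 1 * fderiv ℝ (tubeSigma p B) y u) = _
    rfl
  · show HasFDerivAt (fun x : E4 => tubeP p B x 1) _ y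
    exact (hPc 1).congr_fderiv (ContinuousLinearMap.ext fun u => rfl)
  · show HasFDerivAt (fun x : E4 => tubeP p B x 2) _ y
    exact (hPc 2).congr_fderiv (ContinuousLinearMap.ext fun u => rfl)

/-- **`Ψ` is `C^∞`** where `r > 0` and `2P₀ < 1`. [folklore] -/
theorem contDiffAt_tubePsi {y : E4} (hy : 0 < toroidalR y) (hs : 2 * tubeP p B y 0 < 1) :
    ContDiffAt ℝ ∞ (tubePsi p B ε) y := by
  have hσ := contDiffAt_tubeSigma (p := p) (B := B) hy hs
  have hP : ∀ j : Fin 3, ContDiffAt ℝ ∞ (fun x : E4 => tubeP p B x j) y := fun j =>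
    contDiffAt_euclidean.1 (contDiffAt_tubeP hy) j
  rw [contDiffAt_euclidean]
  intro i
  fin_cases i
  · show ContDiffAt ℝ ∞ (fun x : E4 => tubeSigma p B x * x 0) y
    have h0 : ContDiffAt ℝ ∞ (fun x : E4 => x 0) y := by fun_prop
    exact hσ.mul h0
  · show ContDiffAt ℝ ∞ (fun x : E4 => ε * (tubeSigma p B x * x 1)) y
    have h1 : ContDiffAt ℝ ∞ (fun x : E4 => x 1) y := by fun_prop
    exact contDiffAt_const.mul (hσ.mul h1)
  · show ContDiffAt ℝ ∞ (fun x : E4 => tubeP p B x 1) y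
    exact hP 1
  · show ContDiffAt ℝ ∞ (fun x : E4 => tubeP p B x 2) y
    exact hP 2

/-- **`r²(Ψ y) = 1 − 2P(y)₀`** (`ε² = 1`). [folklore] -/
theorem rsq_tubePsi {y : E4} (hy : 0 < toroidalR y) (hs : 2 * tubeP p B y 0 < 1) (hε : ε ^ 2 = 1) :
    rsq (tubePsi p B ε y) = 1 - 2 * tubeP p B y 0 := by
  rw [← tubeSigma_sq_mul hy hs]
  simp only [rsq, tubePsi_apply_zero, tubePsi_apply_one]
  linear_combination (tubeSigma p B y * y 1) ^ 2 * hε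

/-- **`Z ∘ Ψ = P`.** [folklore] -/
theorem zMap_tubePsi {y : E4} (hy : 0 < toroidalR y) (hs : 2 * tubeP p B y 0 < 1) (hε : ε ^ 2 = 1) :
    zMap (tubePsi p B ε y) = tubeP p B y := by
  ext i
  fin_cases i
  · show zMap (tubePsi p B ε y) 0 = tubeP p B y 0
    rw [zMap_apply_zero, rsq_tubePsi hy hs hε]
    ring
  · rfl
  · rfl

/-- **`dZ_{Ψ y} ∘ dΨ_y = B ∘ dT_y`** — the derivative of `Z ∘ Ψ = P`, by uniqueness of
derivatives (no square root is differentiated by hand). [folklore] -/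
theorem zMapDeriv_comp_tubePsiDeriv {y : E4} (hy : 0 < toroidalR y) (hs : 2 * tubeP p B y 0 < 1)
    (hε : ε ^ 2 = 1) :
    (zMapDeriv (tubePsi p B ε y)).comp (tubePsiDeriv p B ε y) = B.comp (tubeTDeriv y) := by
  have h1 : HasFDerivAt (zMap ∘ tubePsi p B ε)
      ((zMapDeriv (tubePsi p B ε y)).comp (tubePsiDeriv p B ε y)) y :=
    (hasFDerivAt_zMap _).comp y (hasFDerivAt_tubePsi hy hs)
  have heq : (zMap ∘ tubePsi p B ε) =ᶠ[𝓝 y] tubeP p B :=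
    (eventually_tube_nhds hy hs).mono fun x hx => zMap_tubePsi hx.1 hx.2 hε
  exact (h1.congr_of_eventuallyEq heq.symm).unique (hasFDerivAt_tubeP hy) |> fun h => by
    simpa using h

/-- `dZ_{Ψ y}(dΨ_y u) = B(dT_y u)`. [folklore] -/
theorem zMapDeriv_tubePsiDeriv {y : E4} (hy : 0 < toroidalR y) (hs : 2 * tubeP p B y 0 < 1)
    (hε : ε ^ 2 = 1) (u : E4) :
    zMapDeriv (tubePsi p B ε y) (tubePsiDeriv p B ε y u) = B (tubeTDeriv y u) := by
  have := congrArg (fun L : E4 →L[ℝ] E3 => L u) (zMapDeriv_comp_tubePsiDeriv hy hs hε)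
  simpa using this

/-- **`θ ∘ dΨ = ε θ`**: `dθ_{Ψ y}(dΨ_y u) = ε dθ_y(u)` (the unknown `dσ` cancels). [folklore] -/
theorem thetaCov_tubePsi {y : E4} (hy : 0 < toroidalR y) (hs : 2 * tubeP p B y 0 < 1)
    (hε : ε ^ 2 = 1) (u : E4) :
    thetaCov (tubePsi p B ε y) (tubePsiDeriv p B ε y u) = ε * thetaCov y u := by
  have hσ : tubeSigma p B y ≠ 0 := (tubeSigma_pos hy hs).ne'
  have hr : rsq y ≠ 0 := by
    rw [rsq_eq_toroidalR_sq]; positivity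
  have hrsq : rsq (tubePsi p B ε y) = tubeSigma p B y ^ 2 * rsq y := by
    simp only [rsq, tubePsi_apply_zero, tubePsi_apply_one]
    linear_combination (tubeSigma p B y * y 1) ^ 2 * hε
  rw [thetaCov_apply, thetaCov_apply, hrsq]
  simp only [tubePsi_apply_zero, tubePsi_apply_one, tubePsiDeriv_apply_zero,
    tubePsiDeriv_apply_one]
  field_simp
  linear_combination (y 0 * u 1 * tubeSigma p B y ^ 2 * 0) * hε

/-! #### The tube clauses of the named fact for `Ψ` -/

variable {g : E3 → ℝ} {lam : E3 → E3 →L[ℝ] ℝ}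

/-- `ε = ±1 ⇒ ε² = 1`. [folklore] -/
theorem sq_eq_one_of_eq_one_or (hε : ε = 1 ∨ ε = -1) : ε ^ 2 = 1 := by
  rcases hε with h | h <;> simp [h]

/-- **`Ψ* dα' = formT` pointwise on the flat solid torus.**  If in the affine chart
`ξ ↦ p + Bξ` the pair `(g, λ)` has Honda's derivatives on the `δ`-ball — `dg(Bw) = ε dQ_ξ(w)` and
`dλ(Bv, Bw) = ⋆₃dQ_ξ(v, w)` — then for `y ∈ U_δ` the `2`-form `d(Z*λ + (½ − g∘Z)dθ)` at `Ψ y` on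
`dΨ u, dΨ v` is Taubes' `formT(y)(u, v)`:  `dα' = Z*dλ + dθ∧Z*dg`, `Z∘Ψ = P = p + B∘T`,
`dθ∘dΨ = ε dθ`, `ε² = 1`, and `T*(dt∧dQ + ⋆₃dQ) = formT`. [cite: Taubes1998S1B3, eq. (1.1)] -/
theorem birthForm_tubePsi_pullback (hg : ContDiff ℝ ∞ g) (hl : ContDiff ℝ ∞ lam) {δ : ℝ}
    (hδ : 0 < δ) (hδ1 : δ ≤ 1) (hε : ε ^ 2 = 1)
    (hP0 : ∀ ξ : E3, ‖ξ‖ < δ → 2 * (p + B ξ) 0 < 1)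
    (hgm : ∀ ξ : E3, ‖ξ‖ < δ → ∀ w : E3, fderiv ℝ g (p + B ξ) (B w) = ε * modelDQ3 ξ w)
    (hlm : ∀ ξ : E3, ‖ξ‖ < δ → ∀ v w : E3,
      fderiv ℝ lam (p + B ξ) (B v) (B w) - fderiv ℝ lam (p + B ξ) (B w) (B v) =
        modelStarDQ3 ξ v w)
    {y : E4} (hy : y ∈ flatSolidTorus δ) (u v : E4) :
    extDeriv (oneForm (birthCov g lam)) (tubePsi p B ε y)
        ![fderiv ℝ (tubePsi p B ε) y u, fderiv ℝ (tubePsi p B ε) y v] =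
      untwistedTubeForm y u v := by
  have hr : 0 < toroidalR y := toroidalR_pos_of_mem_flatSolidTorus hδ.le hδ1 hy
  have hT : ‖tubeT y‖ < δ := norm_tubeT_lt hδ hy
  have hs : 2 * tubeP p B y 0 < 1 := hP0 _ hT
  have hrsq : 0 < rsq (tubePsi p B ε y) := by
    rw [rsq_tubePsi hr hs hε]; linarith
  rw [(hasFDerivAt_tubePsi hr hs).fderiv, extDeriv_birthForm_apply hg hl hrsq,
    zMapDeriv_tubePsiDeriv hr hs hε, zMapDeriv_tubePsiDeriv hr hs hε, zMap_tubePsi hr hs hε,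
    thetaCov_tubePsi hr hs hε, thetaCov_tubePsi hr hs hε]
  rw [show tubeP p B y = p + B (tubeT y) from rfl, hlm _ hT, hgm _ hT, hgm _ hT,
    thetaCov_apply_eq_toroidalDt, thetaCov_apply_eq_toroidalDt]
  simp only [modelStarDQ3, modelDQ3, tubeT_apply_zero, tubeT_apply_one, tubeT_apply_two,
    tubeTDeriv_apply_zero, tubeTDeriv_apply_one, tubeTDeriv_apply_two,
    daCov_apply_eq_toroidalDa, untwistedTubeForm, untwistedDQ]
  linear_combination (toroidalDt y u *
      ((toroidalR y - 1) * toroidalDa y v + y 2 * v 2 - 2 * y 3 * v 3) -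
    toroidalDt y v * ((toroidalR y - 1) * toroidalDa y u + y 2 * u 2 - 2 * y 3 * u 3)) * hε

/-- **`Ψ` is injective on the flat solid torus** (`B` injective, `ε = ±1`): `Z∘Ψ = p + B∘T`
recovers `T y`, i.e. `r, y₂, y₃`, and then `σ > 0` recovers `y₀, y₁`. [folklore] -/
theorem tubePsi_injOn {δ : ℝ} (hδ : 0 < δ) (hδ1 : δ ≤ 1) (hε : ε ^ 2 = 1)
    (hB : Function.Injective B) (hP0 : ∀ ξ : E3, ‖ξ‖ < δ → 2 * (p + B ξ) 0 < 1) :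
    Set.InjOn (tubePsi p B ε) (flatSolidTorus δ) := by
  intro y hy y' hy' h
  have hr := toroidalR_pos_of_mem_flatSolidTorus hδ.le hδ1 hy
  have hr' := toroidalR_pos_of_mem_flatSolidTorus hδ.le hδ1 hy'
  have hs : 2 * tubeP p B y 0 < 1 := hP0 _ (norm_tubeT_lt hδ hy)
  have hs' : 2 * tubeP p B y' 0 < 1 := hP0 _ (norm_tubeT_lt hδ hy')
  have hε0 : ε ≠ 0 := by
    rintro rfl; norm_num at hε
  have h0 : tubeSigma p B y * y 0 = tubeSigma p B y' * y' 0 := by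
    simpa using congrArg (fun w : E4 => w 0) h
  have h1 : tubeSigma p B y * y 1 = tubeSigma p B y' * y' 1 := by
    have := congrArg (fun w : E4 => w 1) h
    simpa [hε0] using this
  have h2 : tubeP p B y 1 = tubeP p B y' 1 := by simpa using congrArg (fun w : E4 => w 2) h
  have h3 : tubeP p B y 2 = tubeP p B y' 2 := by simpa using congrArg (fun w : E4 => w 3) h
  have hP0eq : tubeP p B y 0 = tubeP p B y' 0 := by
    have e1 := tubeSigma_sq_mul (p := p) (B := B) hr hs
    have e2 := tubeSigma_sq_mul (p := p) (B := B) hr' hs'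
    have : tubeSigma p B y ^ 2 * (y 0 ^ 2 + y 1 ^ 2) =
        tubeSigma p B y' ^ 2 * (y' 0 ^ 2 + y' 1 ^ 2) := by
      linear_combination (tubeSigma p B y * y 0 + tubeSigma p B y' * y' 0) * h0 +
        (tubeSigma p B y * y 1 + tubeSigma p B y' * y' 1) * h1
    linarith
  have hPeq : tubeP p B y = tubeP p B y' := by
    ext i
    fin_cases i
    · exact hP0eq
    · exact h2
    · exact h3
  have hTeq : tubeT y = tubeT y' := by
    have : B (tubeT y) = B (tubeT y') := add_left_cancel hPeq
    exact hB this
  have hreq : toroidalR y = toroidalR y' := by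
    have := congrArg (fun w : E3 => w 0) hTeq
    simpa using this
  have hy2 : y 2 = y' 2 := by simpa using congrArg (fun w : E3 => w 1) hTeq
  have hy3 : y 3 = y' 3 := by simpa using congrArg (fun w : E3 => w 2) hTeq
  have hσeq : tubeSigma p B y = tubeSigma p B y' := by
    unfold tubeSigma
    rw [hP0eq, hreq]
  have hσ : tubeSigma p B y ≠ 0 := (tubeSigma_pos hr hs).ne'
  have hy0 : y 0 = y' 0 := by
    rw [← hσeq] at h0
    exact mul_left_cancel₀ hσ h0
  have hy1 : y 1 = y' 1 := by
    rw [← hσeq] at h1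
    exact mul_left_cancel₀ hσ h1
  ext i
  fin_cases i
  · exact hy0
  · exact hy1
  · exact hy2
  · exact hy3

/-- **`dΨ_y` is injective** (`B` injective, `ε = ±1`, `r > 0`, `2P₀ < 1`): from
`dZ∘dΨ = B∘dT` and the explicit first two components. [folklore] -/
theorem tubePsiDeriv_injective {y : E4} (hr : 0 < toroidalR y) (hs : 2 * tubeP p B y 0 < 1)
    (hε : ε ^ 2 = 1) (hB : Function.Injective B) :
    Function.Injective (tubePsiDeriv p B ε y) := by
  have hε0 : ε ≠ 0 := by
    rintro rfl; norm_num at hε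
  have hσ : tubeSigma p B y ≠ 0 := (tubeSigma_pos hr hs).ne'
  refine (injective_iff_map_eq_zero _).2 fun u hu => ?_
  have hZ : B (tubeTDeriv y u) = 0 := by
    rw [← zMapDeriv_tubePsiDeriv hr hs hε u, hu, _root_.map_zero]
  have hT : tubeTDeriv y u = 0 := hB (hZ.trans (_root_.map_zero B).symm)
  have hda : daCov y u = 0 := by simpa using congrArg (fun w : E3 => w 0) hT
  have hu2 : u 2 = 0 := by simpa using congrArg (fun w : E3 => w 1) hT
  have hu3 : u 3 = 0 := by simpa using congrArg (fun w : E3 => w 2) hT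
  have h0 : tubeSigma p B y * u 0 + y 0 * fderiv ℝ (tubeSigma p B) y u = 0 := by
    simpa using congrArg (fun w : E4 => w 0) hu
  have h1 : tubeSigma p B y * u 1 + y 1 * fderiv ℝ (tubeSigma p B) y u = 0 := by
    have := congrArg (fun w : E4 => w 1) hu
    simpa [hε0] using this
  have hsum : y 0 * u 0 + y 1 * u 1 = 0 := by
    rw [daCov_apply] at hda
    rcases mul_eq_zero.1 hda with h | h
    · exact absurd h (inv_ne_zero hr.ne')
    · exact h
  have hrr : y 0 ^ 2 + y 1 ^ 2 ≠ 0 := by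
    rw [← toroidalR_sq]; positivity
  have hD : fderiv ℝ (tubeSigma p B) y u = 0 := by
    have : (y 0 ^ 2 + y 1 ^ 2) * fderiv ℝ (tubeSigma p B) y u = 0 := by
      linear_combination y 0 * h0 + y 1 * h1 - tubeSigma p B y * hsum
    rcases mul_eq_zero.1 this with h | h
    · exact absurd h hrr
    · exact h
  have hu0 : u 0 = 0 := by
    rw [hD, mul_zero, add_zero] at h0
    exact (mul_eq_zero.1 h0).resolve_left hσ
  have hu1 : u 1 = 0 := by
    rw [hD, mul_zero, add_zero] at h1
    exact (mul_eq_zero.1 h1).resolve_left hσ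
  ext i
  fin_cases i
  · simpa using hu0
  · simpa using hu1
  · simpa using hu2
  · simpa using hu3

/-- **The tube stays in the ball of radius `2 + ‖p‖ + ‖B‖`**: `‖Ψ y‖² = (1 − 2P₀) + P₁² + P₂²
≤ (1 + ‖P y‖)²` and `‖P y‖ ≤ ‖p‖ + ‖B‖δ`. [folklore] -/
theorem norm_tubePsi_lt {δ : ℝ} (hδ : 0 < δ) (hδ1 : δ ≤ 1) (hε : ε ^ 2 = 1)
    (hP0 : ∀ ξ : E3, ‖ξ‖ < δ → 2 * (p + B ξ) 0 < 1) {y : E4} (hy : y ∈ flatSolidTorus δ) :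
    ‖tubePsi p B ε y‖ < 2 + ‖p‖ + ‖B‖ := by
  have hr := toroidalR_pos_of_mem_flatSolidTorus hδ.le hδ1 hy
  have hT := norm_tubeT_lt hδ hy
  have hs : 2 * tubeP p B y 0 < 1 := hP0 _ hT
  have hn : ‖tubePsi p B ε y‖ ^ 2 =
      (1 - 2 * tubeP p B y 0) + tubeP p B y 1 ^ 2 + tubeP p B y 2 ^ 2 := by
    rw [EuclideanSpace.norm_sq_eq, ← tubeSigma_sq_mul hr hs]
    simp [Fin.sum_univ_four, Real.norm_eq_abs, sq_abs]
    linear_combination (tubeSigma p B y * y 1) ^ 2 * hε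
  have hPn : ‖tubeP p B y‖ ≤ ‖p‖ + ‖B‖ := by
    unfold tubeP
    calc ‖p + B (tubeT y)‖ ≤ ‖p‖ + ‖B (tubeT y)‖ := norm_add_le _ _
      _ ≤ ‖p‖ + ‖B‖ * ‖tubeT y‖ := by gcongr; exact B.le_opNorm _
      _ ≤ ‖p‖ + ‖B‖ * 1 := by gcongr; linarith
      _ = ‖p‖ + ‖B‖ := by ring
  have hc0 : |tubeP p B y 0| ≤ ‖tubeP p B y‖ := by
    simpa [Real.norm_eq_abs] using PiLp.norm_apply_le (tubeP p B y) 0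
  have hP12 : tubeP p B y 1 ^ 2 + tubeP p B y 2 ^ 2 ≤ ‖tubeP p B y‖ ^ 2 := by
    rw [EuclideanSpace.norm_sq_eq]
    simp [Fin.sum_univ_three, Real.norm_eq_abs, sq_abs]
    positivity
  have hsq : ‖tubePsi p B ε y‖ ^ 2 ≤ (1 + ‖tubeP p B y‖) ^ 2 := by
    rw [hn]
    nlinarith [abs_le.1 hc0, norm_nonneg (tubeP p B y)]
  have hle : ‖tubePsi p B ε y‖ ≤ 1 + ‖tubeP p B y‖ :=
    le_of_pow_le_pow_left₀ two_ne_zero (by positivity) hsq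
  linarith

/-- **The points of `ℝ⁴` lying over `p` are on the image of the core circle**: if `r²(y) > 0` and
`Z y = p` then `y = Ψ y'` with `y' = (y₀/ρ, εy₁/ρ, 0, 0) ∈ C₀`, `ρ = √(r²(y))`. [folklore] -/
theorem exists_flatCoreCircle_tubePsi_eq (hε : ε ^ 2 = 1) {y : E4} (hy : 0 < rsq y)
    (hp : zMap y = p) : ∃ y' ∈ flatCoreCircle, tubePsi p B ε y' = y := by
  set ρ : ℝ := Real.sqrt (rsq y) with hρ
  have hρpos : 0 < ρ := Real.sqrt_pos.2 hy
  have hρsq : ρ ^ 2 = rsq y := Real.sq_sqrt hy.le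
  have hρ0 : ρ ≠ 0 := hρpos.ne'
  set y' : E4 := WithLp.toLp 2 ![y 0 / ρ, ε * y 1 / ρ, 0, 0] with hy'
  have e0 : y' 0 = y 0 / ρ := rfl
  have e1 : y' 1 = ε * y 1 / ρ := rfl
  have e2 : y' 2 = 0 := rfl
  have e3 : y' 3 = 0 := rfl
  have hcirc : y' 0 ^ 2 + y' 1 ^ 2 = 1 := by
    rw [e0, e1]
    field_simp
    rw [hρsq]
    unfold rsq
    linear_combination y 1 ^ 2 * hε
  have hcore : y' ∈ flatCoreCircle := ⟨hcirc, e2, e3⟩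
  have hr' : toroidalR y' = 1 := by
    unfold toroidalR
    rw [hcirc, Real.sqrt_one]
  have hT' : tubeT y' = 0 := by
    ext i
    fin_cases i
    · simp [hr']
    · simp [e2]
    · simp [e3]
  have hP' : tubeP p B y' = p := by simp [tubeP, hT']
  have hP'0 : 1 - 2 * tubeP p B y' 0 = rsq y := by
    rw [hP', ← hp, zMap_apply_zero]; ring
  have hσ' : tubeSigma p B y' = ρ := by
    unfold tubeSigma
    rw [hP'0, hr', div_one]
  refine ⟨y', hcore, ?_⟩
  ext i
  fin_cases i
  · show tubeSigma p B y' * y' 0 = y 0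
    rw [hσ', e0]
    field_simp
  · show ε * (tubeSigma p B y' * y' 1) = y 1
    rw [hσ', e1]
    field_simp
    linear_combination y 1 * hε
  · show tubeP p B y' 1 = y 2
    rw [hP', ← hp]
    rfl
  · show tubeP p B y' 2 = y 3
    rw [hP', ← hp]
    rfl

end TubeMap

/-! ### The reduction: an explicit `3`-dimensional pair with two Honda germs gives the fact -/

section Assembly

variable {g : E3 → ℝ} {lam : E3 → E3 →L[ℝ] ℝ}

/-- **An (untwisted) flat Taubes tube of `sf` of radius `δ` inside the ball `B_R`** — verbatim
the `let IsTube` of `flatNearSymplecticTaubesTubes_exists` with its `let`s named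
(`flatSolidTorus`, `untwistedTubeForm`). [cite: Taubes1998S1B3, eq. (1.1) and §1.c] -/
def IsFlatTaubesTube (R δ : ℝ) (sf : E4 → E4 [⋀^Fin 2]→L[ℝ] ℝ) (Ψ : E4 → E4) : Prop :=
  ContDiffOn ℝ ∞ Ψ (flatSolidTorus δ) ∧ Set.InjOn Ψ (flatSolidTorus δ) ∧
    (∀ y ∈ flatSolidTorus δ, Function.Injective (fderiv ℝ Ψ y)) ∧
    (∀ y ∈ flatSolidTorus δ, ‖Ψ y‖ < R) ∧
    (∀ y ∈ flatSolidTorus δ, ∀ u v : E4,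
      sf (Ψ y) ![fderiv ℝ Ψ y u, fderiv ℝ Ψ y v] = untwistedTubeForm y u v)

/-- **`Ψ` is a flat Taubes tube of `d(Z*λ + (½ − g∘Z)dθ)`** for Honda germ data `(p, B, ε)`
of the pair `(g, λ)` on the `δ`-ball (`0 < δ ≤ 1`, `B` injective, `ε = ±1`, `2P₀ < 1` on the
ball), inside every ball of radius `R ≥ 2 + ‖p‖ + ‖B‖`. [cite: Taubes1998S1B3, eq. (1.1) and §1.c] -/
theorem isFlatTaubesTube_tubePsi (hg : ContDiff ℝ ∞ g) (hl : ContDiff ℝ ∞ lam) {δ R : ℝ}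
    {p : E3} {B : E3 →L[ℝ] E3} {ε : ℝ} (hδ : 0 < δ) (hδ1 : δ ≤ 1) (hε : ε ^ 2 = 1)
    (hB : Function.Injective B) (hR : 2 + ‖p‖ + ‖B‖ ≤ R)
    (hP0 : ∀ ξ : E3, ‖ξ‖ < δ → 2 * (p + B ξ) 0 < 1)
    (hgm : ∀ ξ : E3, ‖ξ‖ < δ → ∀ w : E3, fderiv ℝ g (p + B ξ) (B w) = ε * modelDQ3 ξ w)
    (hlm : ∀ ξ : E3, ‖ξ‖ < δ → ∀ v w : E3,
      fderiv ℝ lam (p + B ξ) (B v) (B w) - fderiv ℝ lam (p + B ξ) (B w) (B v) =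
        modelStarDQ3 ξ v w) :
    IsFlatTaubesTube R δ (extDeriv (oneForm (birthCov g lam))) (tubePsi p B ε) := by
  have hrs : ∀ y ∈ flatSolidTorus δ, 0 < toroidalR y ∧ 2 * tubeP p B y 0 < 1 := fun y hy =>
    ⟨toroidalR_pos_of_mem_flatSolidTorus hδ.le hδ1 hy, hP0 _ (norm_tubeT_lt hδ hy)⟩
  refine ⟨fun y hy => (contDiffAt_tubePsi (hrs y hy).1 (hrs y hy).2).contDiffWithinAt,
    tubePsi_injOn hδ hδ1 hε hB hP0, fun y hy => ?_,
    fun y hy => lt_of_lt_of_le (norm_tubePsi_lt hδ hδ1 hε hP0 hy) hR,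
    fun y hy u v => birthForm_tubePsi_pullback hg hl hδ hδ1 hε hP0 hgm hlm hy u v⟩
  rw [(hasFDerivAt_tubePsi (hrs y hy).1 (hrs y hy).2).fderiv]
  exact tubePsiDeriv_injective (hrs y hy).1 (hrs y hy).2 hε hB

/-- **Near the axis the transplanted form is `ω₀`**, hence non-degenerate there. [folklore] -/
theorem extDeriv_birthForm_eq_std_of_rsq_lt {η : ℝ}
    (hstd : ∀ q : E3, 1 / 2 - η < q 0 → g q = q 0 ∧ lam q = stdCov3 q) {y : E4}
    (hy : rsq y < 2 * η) (a b : E4) :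
    extDeriv (oneForm (birthCov g lam)) y ![a, b] = stdSymplecticForm a b := by
  refine extDeriv_apply_eq_stdSymplecticForm_of_eventuallyEq ?_ a b
  have hopen : IsOpen {x : E4 | rsq x < 2 * η} := isOpen_lt contDiff_rsq.continuous continuous_const
  filter_upwards [hopen.mem_nhds hy] with x hx
  show oneForm (birthCov g lam) x = stdPrimitive x
  unfold stdPrimitive
  rw [oneForm_eq_comp, oneForm_eq_comp]
  simp only
  rw [birthCov_eq_stdPrimitiveCLM_of_rsq_lt hstd hx]

/-- **Reduction of `flatNearSymplecticTaubesTubes_exists` to an explicit `3`-dimensional pair.**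
Let `(g, λ)` be a `C^∞` function and `1`-form on `ℝ³`, standard (`g = z`, `λ = λ₀ = ½(x₁dx₂ − x₂dx₁)`)
above height `½ − η` and off the `R₁`-ball, whose density `D = (dλ∧dg)/dvol` vanishes only at two
points `p₁, p₂`, at each of which the pair has HONDA'S GERM in an affine chart `ξ ↦ pᵢ + Bᵢξ`
(`Bᵢ` injective, `εᵢ = ±1`) on the `δ`-ball: `dg(Bᵢw) = εᵢ dQ_ξ(w)`, `dλ(Bᵢv, Bᵢw) = ⋆₃dQ_ξ(v, w)`
(`Q = ½(a² + b²) − c²`), the two chart balls being disjoint and below height `½`.  Then the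
`2`-form `sf = d(Z*λ + (½ − g∘Z)dθ)` on `ℝ⁴` with the two tubes `Ψᵢ = (σy₀, εᵢσy₁, Pᵢ(y)₁, Pᵢ(y)₂)`
witnesses the named fact: it is `C^∞`, closed (`d∘d = 0`), `= ω₀` off the ball of radius
`2R₁ + 4`, pulls back to Taubes' `formT` under both tubes, the tube images are disjoint, and it is
non-degenerate off the two core circles (`Pf(sf) = D∘Z` off the axis, `sf = ω₀` on the axis, and
`Z⁻¹(pᵢ) = Ψᵢ(C₀)`).  This is the `t`-invariant architecture of Perutz 2006 Prop. 1.5 / Rem. 1.9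
with Honda's exact model built in; what it leaves to exhibit is the explicit pair.
[cite: Perutz2006, Prop. 1.5 and Rem. 1.9] [cite: Taubes1998S1B3, eq. (1.1)] -/
theorem flatNearSymplecticTaubesTubes_exists_of_calabiPair {η R₁ δ : ℝ} {p₁ p₂ : E3}
    {B₁ B₂ : E3 →L[ℝ] E3} {ε₁ ε₂ : ℝ} (hη : 0 < η) (hR₁ : 0 ≤ R₁) (hg : ContDiff ℝ ∞ g)
    (hl : ContDiff ℝ ∞ lam)
    (hstd : ∀ q : E3, (1 / 2 - η < q 0 ∨ R₁ < ‖q‖) → g q = q 0 ∧ lam q = stdCov3 q)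
    (hδ : 0 < δ) (hδ1 : δ < 1) (hε₁ : ε₁ ^ 2 = 1) (hε₂ : ε₂ ^ 2 = 1)
    (hB₁ : Function.Injective B₁) (hB₂ : Function.Injective B₂)
    (hP₁ : ∀ ξ : E3, ‖ξ‖ < δ → 2 * (p₁ + B₁ ξ) 0 < 1)
    (hP₂ : ∀ ξ : E3, ‖ξ‖ < δ → 2 * (p₂ + B₂ ξ) 0 < 1)
    (hg₁ : ∀ ξ : E3, ‖ξ‖ < δ → ∀ w : E3, fderiv ℝ g (p₁ + B₁ ξ) (B₁ w) = ε₁ * modelDQ3 ξ w)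
    (hg₂ : ∀ ξ : E3, ‖ξ‖ < δ → ∀ w : E3, fderiv ℝ g (p₂ + B₂ ξ) (B₂ w) = ε₂ * modelDQ3 ξ w)
    (hl₁ : ∀ ξ : E3, ‖ξ‖ < δ → ∀ v w : E3,
      fderiv ℝ lam (p₁ + B₁ ξ) (B₁ v) (B₁ w) - fderiv ℝ lam (p₁ + B₁ ξ) (B₁ w) (B₁ v) =
        modelStarDQ3 ξ v w)
    (hl₂ : ∀ ξ : E3, ‖ξ‖ < δ → ∀ v w : E3,
      fderiv ℝ lam (p₂ + B₂ ξ) (B₂ v) (B₂ w) - fderiv ℝ lam (p₂ + B₂ ξ) (B₂ w) (B₂ v) =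
        modelStarDQ3 ξ v w)
    (hdisj : ∀ ξ ξ' : E3, ‖ξ‖ < δ → ‖ξ'‖ < δ → p₁ + B₁ ξ ≠ p₂ + B₂ ξ')
    (hD : ∀ q : E3, q ≠ p₁ → q ≠ p₂ → density3 g lam q ≠ 0) :
    flatNearSymplecticTaubesTubes_exists := by
  obtain ⟨hsm, hcl, hfar⟩ := birthForm_architecture hη hR₁ hg hl hstd
  set sf := extDeriv (oneForm (birthCov g lam)) with hsf
  set R : ℝ := 2 * R₁ + 4 + (2 + ‖p₁‖ + ‖B₁‖) + (2 + ‖p₂‖ + ‖B₂‖) with hR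
  have hRpos : 0 < R := by positivity
  have hR₁le : 2 + ‖p₁‖ + ‖B₁‖ ≤ R := by
    have := norm_nonneg p₂; have := norm_nonneg B₂; linarith
  have hR₂le : 2 + ‖p₂‖ + ‖B₂‖ ≤ R := by
    have := norm_nonneg p₁; have := norm_nonneg B₁; linarith
  have hT₁ : IsFlatTaubesTube R δ sf (tubePsi p₁ B₁ ε₁) :=
    isFlatTaubesTube_tubePsi hg hl hδ hδ1.le hε₁ hB₁ hR₁le hP₁ hg₁ hl₁
  have hT₂ : IsFlatTaubesTube R δ sf (tubePsi p₂ B₂ ε₂) :=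
    isFlatTaubesTube_tubePsi hg hl hδ hδ1.le hε₂ hB₂ hR₂le hP₂ hg₂ hl₂
  have hfar' : ∀ y : E4, R ≤ ‖y‖ → ∀ a b : E4, sf y ![a, b] = stdSymplecticForm a b :=
    fun y hy a b => hfar y (by
      have := norm_nonneg p₁; have := norm_nonneg B₁
      have := norm_nonneg p₂; have := norm_nonneg B₂; linarith) a b
  have hrs : ∀ {p : E3} {B : E3 →L[ℝ] E3}, (∀ ξ : E3, ‖ξ‖ < δ → 2 * (p + B ξ) 0 < 1) →
      ∀ y ∈ flatSolidTorus δ, 0 < toroidalR y ∧ 2 * tubeP p B y 0 < 1 := fun hP0 y hy =>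
    ⟨toroidalR_pos_of_mem_flatSolidTorus hδ.le hδ1.le hy, hP0 _ (norm_tubeT_lt hδ hy)⟩
  have hdisj' : Disjoint (tubePsi p₁ B₁ ε₁ '' flatSolidTorus δ)
      (tubePsi p₂ B₂ ε₂ '' flatSolidTorus δ) := by
    refine Set.disjoint_left.2 ?_
    rintro _ ⟨y, hy, rfl⟩ ⟨y', hy', h⟩
    have h1 := zMap_tubePsi (ε := ε₁) (hrs hP₁ y hy).1 (hrs hP₁ y hy).2 hε₁
    have h2 := zMap_tubePsi (ε := ε₂) (hrs hP₂ y' hy').1 (hrs hP₂ y' hy').2 hε₂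
    have : tubeP p₁ B₁ y = tubeP p₂ B₂ y' := by rw [← h1, ← h2, h]
    exact hdisj (tubeT y) (tubeT y') (norm_tubeT_lt hδ hy) (norm_tubeT_lt hδ hy') this
  have hnd : ∀ y : E4, y ∉ tubePsi p₁ B₁ ε₁ '' flatCoreCircle ∪ tubePsi p₂ B₂ ε₂ '' flatCoreCircle →
      ∀ a : E4, a ≠ 0 → ∃ b : E4, sf y ![a, b] ≠ 0 := by
    intro y hy a ha
    rcases lt_or_ge 0 (rsq y) with hax | hax
    · refine extDeriv_birthForm_nondegenerate hg hl hax (hD _ ?_ ?_) a ha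
      · intro heq
        obtain ⟨y', hy', hΨ⟩ := exists_flatCoreCircle_tubePsi_eq (B := B₁) hε₁ hax heq
        exact hy (Or.inl ⟨y', hy', hΨ⟩)
      · intro heq
        obtain ⟨y', hy', hΨ⟩ := exists_flatCoreCircle_tubePsi_eq (B := B₂) hε₂ hax heq
        exact hy (Or.inr ⟨y', hy', hΨ⟩)
    · have h0 : rsq y < 2 * η := by linarith
      refine ⟨WithLp.toLp 2 ![-a 1, a 0, -a 3, a 2], ?_⟩
      rw [hsf, extDeriv_birthForm_eq_std_of_rsq_lt (fun q hq => hstd q (Or.inl hq)) h0,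
        stdSymplecticForm_rot_eq_norm_sq]
      exact pow_ne_zero 2 (norm_ne_zero_iff.2 ha)
  exact ⟨R, δ, sf, tubePsi p₁ B₁ ε₁, tubePsi p₂ B₂ ε₂, hRpos, hδ, hδ1, hsm, hcl, hfar', hT₁, hT₂,
    hdisj', hnd⟩

end Assembly

end Literature.Geometry.Symplectic

end
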